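import Literature.AlgebraicGeometry.HodgeTheory.RankOneCentreTimesCMCurveProductSpan
import Literature.AlgebraicGeometry.HodgeTheory.DivisorClassesHardLefschetz
import Literature.AlgebraicGeometry.HodgeTheory.WeilClassesProducts
import Literature.AlgebraicGeometry.HodgeTheory.WeilClassesMoonenZarhinCriterionHolds
import Literature.AlgebraicGeometry.HodgeTheory.WeilTypeProducts
import Literature.AlgebraicGeometry.HodgeTheory.WeilTypeHodgeRingIsogenyInvariance
import Literature.AlgebraicGeometry.HodgeTheory.WeilClassesFourfolds
import Literature.AlgebraicGeometry.HodgeTheory.HodgeClassesProductSpanCriterion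
import Literature.AlgebraicGeometry.Motives.HodgeThetaAnnihilatorUnitaryTimesCMCurve
import HarnessLib

/-!
# `T × E_k`, `T` a threefold of unitary type `(2,1)` over `k = ℚ(√-d) = End⁰(T)`, `E_k` an elliptic curve with CM by the SAME `k`: `B•(T × E_k) = D• + W_k` (Moonen–Zarhin 1999 Thm. 0.1 (1), case (a1); §5 (5.3))

Family `hodge`, layer `Literature/AlgebraicGeometry/HodgeTheory`. Research context: cell `pub-hodge-ring2` (HONEST
FRAMING: research route conditional on HC_CM; not a corollary; Q11.4-sentence-2 already refuted in dim ≥ 3),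
Literature lane, programme R30 — the companion of `UnitaryTypeOneTimesCMCurveProductSpan` (programme R29, case (g),
multiplicities `(m,1)`, `m ≥ 3`) for `m = 2`, where exceptional WEIL classes appear. Same Lie step
`Motives/HodgeThetaAnnihilatorUnitaryTimesCMCurve` (the annihilator of a Hodge class contains `ι_T 𝔰𝔲_k(H¹T, ψ) π_T`,
i.e. «`Hg(X) ⊇ {1} × SU_k`» in Lie form, valid for `m = 2`). UNCONDITIONAL (no HC_CM); theorems only (no definition,
no named fact, D-0026; nothing admitted; Markman's theorem enters ONE corollary as an explicit hypothesis).

PRINTED RESULTS. B. Moonen, Yu. Zarhin, *Hodge classes on abelian varieties of low dimension*, Math. Ann. 315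
(1999) 711–733 [held: `paper:arxiv-math_9901113`, locators = held TeX chunks]. Case (a) (chunk p0001): «The abelian
variety `X` is isogenous to a product `X₁ × X₂` where `X₁` is an elliptic curve with complex multiplication by an
imaginary quadratic field `k` and where `X₂` is a simple abelian threefold such that there exists an embedding
`k ↪ End⁰(X₂)`». Thm. 0.1 (1) (chunk p0001): «Suppose we are in case (a) or (b). Then the Hodge ring `B•(X)` is
generated by the subalgebra `D•(X)` of divisor classes together with the space of Weil classes `W_k ⊂ B²(X)`. The
Hodge group `Hg(X)` is strictly contained in `Sp_D(V,φ)`», and «in the cases (a), (b) and (c) the Weil classes are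
really needed to generate the Hodge ring; in these cases we have `D²(X) ≠ B²(X)`». §5 (5.3) (chunks p0008–p0009):
«Either (a1) `F = k`, or (a2) `F` is a sextic CM-field. Embed `k` as a subfield of `End⁰(X)` such that it acts with
multiplicities `(2,2)` on the tangent space `T_{X,0}`. (… `k` acts on `T_{X₂,0}` with multiplicities `(1,2)` …
either `α ↦ (α, α)` … or `α ↦ (ᾱ, α)` gives an embedding as required.) Then the space `W_k ⊂ H⁴(X,ℚ)` consists of
Hodge classes … `Hg(X) = {(u₁,u₂) ∈ U_k × U_k(V_{X₂},ψ_{X₂}) ∣ u₁ · det_k(u₂) = 1}` in case (a1) … The Hodge classes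
in `H²(X₁,ℚ) ⊗ H²(X₂,ℚ)` … and those in `H⁰(X₁,ℚ) ⊗ H⁴(X₂,ℚ)` … are linear combination of products of divisor classes.
The space of Weil classes `W_k` is a subspace of `H¹(X₁,ℚ) ⊗ H³(X₂,ℚ)`». (1.9) (chunk p0004): Weil classes
`W_k = ⋀^{2n}_k H¹(X,ℚ)`.

THIS FILE (case (a1), `End⁰(X₂) = k`, in the tree's Lie/word language). §1 the WORD-COMBINATORIAL TRICHOTOMY
`kindWeight_eq_zero_or_weilWord_of_rootDiffWeights` for multiplicities `(2,1)` (ONE copy of `H¹(T) ⊕ H¹(E)`: a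
repeated-letter-free `Θ`-balanced word killed by all root differences `E_ii - E_jj` of `𝔰𝔩(W)` is `T`-kind balanced OR
the `+`-Weil word OR the `-`-Weil word). §2 THE INVARIANCE THEOREM WITH WEIL WORDS
`AVSlots.exists_coeff_eq_zero_off_balanced_or_weilWord_of_prod_unitaryTwoOne_cmCurve` (R29's §3 proof verbatim up to
the root-difference weights; the eigen-properties of the adapted letters are exported: the `κ ℓ`-member of a `T`-pair
and the kind-`1` letter of `E` are `μ̄₀`-eigenvectors, the others `μ₀`-eigenvectors — for `E` because the Hodge pieces of
`H¹(E)` are LINES). §3 Weil words are Weil classes (`cupPowOne_mem_pullbackEigenclasses_pow` on `T × E` with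
`φ × χ`) and **`(T × E, φ × χ)` is of WEIL TYPE `(2, d)`** (`isWeilType_prod_cmCurve_of_unitaryTwoOne`; multiplicities
add, the tree's `finrank_eigenspace_inf_hodgeOneZero_prod`). §4 Künneth degrees: Weil words carry exactly ONE
`E`-letter, balanced words an EVEN number of `T`-letters. §5 **`IsDivisorWeilGenerated (T × E) (φ × χ) 2 d`**
(`isDivisorWeilGenerated_prod_cmCurve_of_unitaryTwoOne`): the Weil part `c_W` of a rational `(2,2)`-class `c` is its
Künneth component of `E`-degree `1` (`complexBetti_kunneth_bijective`, `isRationalClass_kunneth_symm_apply`), hence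
RATIONAL and of type `(2,2)`; `c - c_W` is then a combination of products of rational Hodge classes of `T` and `E`
(the tree's typed criterion `mem_span_hodgeProductClasses_of_mem_span_pureType`), i.e. of divisor classes
(`dim T = 3`, `dim E = 1`); degrees `≠ 4` are Lefschetz on a fourfold. §6 the isogeny class (`∃ ψ D, IsWeilType X ψ 2 D ∧
IsDivisorWeilGenerated X ψ 2 D` for `X ∼ T × E`), and THE HODGE CONJECTURE FOR `T × E_k` MODULO the tree's named fact
`Markman2025_weilClasses_algebraic_abelianFourfold` (hypothesis; van Geemen's reduction Thm. 6.12).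

SCOPE (numbers, not adjectives). Proved: `T` any abelian threefold with `dim_ℚ End⁰(T) = 2`, `φ ≫ φ = -d`,
multiplicity `1` at `μ₀`; `E` any elliptic curve with `χ ≫ χ = -d` (same `d`) and multiplicity `1` at `μ₀` — the
printed normalisation «multiplicities `(2,2)`» (for the other sign replace `χ` by `-χ`; for `χ ≫ χ = -d'` with
`ℚ(√-d') = ℚ(√-d)` rescale both endomorphisms). NOT covered: case (a2) (`F` sextic); `D²(X) ≠ B²(X)` and «`Hg(X)` is
strictly contained in `Sp_D(V,φ)`»; the identification `B² ∩ (H¹ ⊗ H³) = W_k` as an EQUALITY (only `⊆ D² + W_k` is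
proved); the algebraicity of `W_k` (Markman 2025 for fourfolds of Weil type with trivial discriminant / Schoen — the
tree's named fact, not discharged here).

## References

* [MoonenZarhin1999LowDim] B. Moonen, Yu. Zarhin, Math. Ann. 315 (1999), Thm. 0.1 (1) with case (a), (1.9), §2
  (2.3), §3 (3.1), §5 (5.3) (held `paper:arxiv-math_9901113` chunks p0001, p0004–p0006, p0008–p0009).
  [cite: MoonenZarhin1999LowDim, Thm. 0.1 (1) with case (a) and §5 (5.3)]
* [vanGeemen1994HodgeAV] B. van Geemen, LNM 1594 (1994), 3.6–3.7, 4.9–4.11, Lemma 5.2, Thm. 6.12.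
  [cite: vanGeemen1994HodgeAV, 4.9 and Thm. 6.12]
* [Deligne1982HodgeCycles] P. Deligne, LNM 900 (1982), I §3 Prop. 3.4, §4 (4.3)–Prop. 4.4.
  [cite: Deligne1982HodgeCycles, I §3 Prop. 3.4]
* [Lombardo2016] D. Lombardo, Ann. Inst. Fourier 66 (2016), Lemma 3.4 (p. 1229). [cite: Lombardo2016, Lemma 3.4 (p. 1229)]
* [Ribet1983] K. Ribet, Amer. J. Math. 105 (1983), Thm. 3. [cite: Ribet1983, Thm. 3]
* [GoodmanWallachGTM255] R. Goodman, N. Wallach, GTM 255, §4.1.1. [cite: GoodmanWallachGTM255, §4.1.1]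
* [HatcherAT2002] A. Hatcher, *Algebraic Topology*, §3.2 Prop. 3.10, Thm. 3.16. [cite: HatcherAT2002, §3.2 Thm. 3.16]
-/

noncomputable section

open scoped TensorProduct
open CategoryTheory Module

namespace Literature.AlgebraicGeometry.HodgeTheory

open Literature.AlgebraicTopology.SingularHomology
open Literature.AlgebraicGeometry.Motives (IsSmoothProjective AbelianVariety bettiCohomology
  ofRatClassBaseChange ofRatClassBaseChange_tmul HodgeTensorFacts hodgeTensorFacts_holds ComplexPoints)
open Literature.Barriers.HodgeConjecture
open Literature.AlgebraicGeometry.Motives.HodgeStructure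
open Literature.AlgebraicGeometry.ComplexMultiplication
open Literature.RepresentationTheory.GeneralLinear
open Literature.NumberTheory.DiophantineGeometry

/-! ### §1 Word combinatorics of the torus `{a + tr_k B = 0}`: the trichotomy for multiplicities `(2,1)` -/
section CombinatoricsTwoOne

variable {hY h d : ℕ}

/-- `∑_t (±1 by kind) = #(kind 0) - #(kind 1)` over any finset of positions. [folklore] -/
private theorem sum_kindSign_eq_card_sub_card' (s : Finset (Fin d)) (η : Fin d → Fin 2) :
    ∑ t ∈ s, (if η t = 0 then (1 : ℤ) else -1) =
      ((s.filter fun t => η t = 0).card : ℤ) - ((s.filter fun t => η t = 1).card : ℤ) := by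
  rw [Finset.card_filter, Finset.card_filter, Nat.cast_sum, Nat.cast_sum, ← Finset.sum_sub_distrib]
  refine Finset.sum_congr rfl fun t _ => ?_
  rcases Fin.exists_fin_two.1 ⟨η t, rfl⟩ with h0 | h1
  · simp [h0]
  · simp [h1]

/-- In `Fin 2`, `x ≠ r` forces `x = 1 - r`. [folklore] -/
private theorem fin2_eq_one_sub_of_ne : ∀ {x r : Fin 2}, x ≠ r → x = 1 - r := by decide

/-- In `Fin 2`, `1 - r ≠ r`. [folklore] -/
private theorem fin2_one_sub_ne : ∀ r : Fin 2, 1 - r ≠ r := by decide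

/-- In a word without repeated letters, at most one position carries a given letter `(place, kind)`. [folklore] -/
private theorem card_filter_place_kind_le_one (P : Fin d → Fin hY ⊕ Fin h) (η : Fin d → Fin 2)
    (hinj : Function.Injective fun t => (P t, η t)) (q : Fin hY ⊕ Fin h) (r : Fin 2) :
    (Finset.univ.filter fun t => P t = q ∧ η t = r).card ≤ 1 := by
  refine Finset.card_le_one.2 fun t ht t' ht' => ?_
  have h1 := (Finset.mem_filter.1 ht).2
  have h2 := (Finset.mem_filter.1 ht').2
  exact hinj (Prod.ext (h1.1.trans h2.1.symm) (h1.2.trans h2.2.symm))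

/-- **The word-combinatorial core for multiplicities `(2,1)`** (Moonen–Zarhin case (a1), §5 (5.3): the torus
`{(u₁,u₂) ∣ u₁ · det_k(u₂) = 1}` on ONE copy of `H¹(T) ⊕ H¹(E)`). Places `Fin hY ⊕ Fin h` (`h ≤ 1`), kinds `κ` of the
`T`-pairs with `#{κ = 0} = #{κ = 1} + 1`, a word `t ↦ (P t, η t)` WITHOUT REPEATED LETTERS, `Θ`-balanced and killed by
every root-difference weight `E_ii - E_jj` (`W`-sign `+1` iff `η t = κ ℓ`). Then EITHER its `T`-kind weight vanishes,
OR it is the `+`-Weil word (exactly the `W`-member of every pair and the `E`-letter of kind `1`), OR it is the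
`-`-Weil word (exactly the `W^⊥`-member of every pair and the `E`-letter of kind `0`). Proof: the signed contents
`c_ℓ ∈ {-1,0,1}` have a common value `c`, the `T`-kind weight is `c · (#{κ=0} - #{κ=1}) = c` and the `E`-kind weight
is `-c` with absolute value `≤ 1`; `c = ±1` pins down every letter.
[cite: MoonenZarhin1999LowDim, Thm. 0.1 (1) with case (a) and §5 (5.3)] [cite: GoodmanWallachGTM255, §4.1.1] -/
theorem kindWeight_eq_zero_or_weilWord_of_rootDiffWeights (κ : Fin hY → Fin 2) (P : Fin d → Fin hY ⊕ Fin h)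
    (η : Fin d → Fin 2) (hinj : Function.Injective fun t => (P t, η t)) (hh : h ≤ 1)
    (hκ : (Finset.univ.filter fun ℓ => κ ℓ = 0).card = (Finset.univ.filter fun ℓ => κ ℓ = 1).card + 1)
    (hΘ : ∑ t, (if η t = 0 then (1 : ℤ) else -1) = 0)
    (hD : ∀ i j : Fin hY, ∑ t, Sum.elim (fun ℓ => (if η t = κ ℓ then (1 : ℤ) else -1) *
        ((if ℓ = i then (1 : ℤ) else 0) - (if ℓ = j then (1 : ℤ) else 0))) (fun _ => (0 : ℤ)) (P t) = 0) :
    (∑ t, Sum.elim (fun _ => if η t = 0 then (1 : ℤ) else -1) (fun _ => (0 : ℤ)) (P t) = 0) ∨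
    ((∀ t, Sum.elim (fun ℓ => η t = κ ℓ) (fun _ => η t = 1) (P t)) ∧ (∀ ℓ, ∃ t, P t = Sum.inl ℓ) ∧
      (∃ t e, P t = Sum.inr e)) ∨
    ((∀ t, Sum.elim (fun ℓ => η t ≠ κ ℓ) (fun _ => η t = 0) (P t)) ∧ (∀ ℓ, ∃ t, P t = Sum.inl ℓ) ∧
      (∃ t e, P t = Sum.inr e)) := by
  classical
  -- the signed content `c ℓ` of the pair `ℓ`
  set c : Fin hY → ℤ := fun ℓ => ∑ t, Sum.elim (fun ℓ' => if ℓ' = ℓ then (if η t = κ ℓ' then (1 : ℤ) else -1) else 0)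
    (fun _ => (0 : ℤ)) (P t) with hc
  -- (1) `c i = c j`
  have hcc : ∀ i j, c i = c j := by
    intro i j
    have h := hD i j
    have hsplit : ∀ t, Sum.elim (fun ℓ => (if η t = κ ℓ then (1 : ℤ) else -1) *
        ((if ℓ = i then (1 : ℤ) else 0) - (if ℓ = j then (1 : ℤ) else 0))) (fun _ => (0 : ℤ)) (P t) =
        Sum.elim (fun ℓ' => if ℓ' = i then (if η t = κ ℓ' then (1 : ℤ) else -1) else 0) (fun _ => (0 : ℤ)) (P t) -
        Sum.elim (fun ℓ' => if ℓ' = j then (if η t = κ ℓ' then (1 : ℤ) else -1) else 0) (fun _ => (0 : ℤ)) (P t) := by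
      intro t
      rcases P t with ℓ | e
      · simp only [Sum.elim_inl]
        split_ifs <;> ring
      · simp
    simp only [hsplit, Finset.sum_sub_distrib] at h
    exact sub_eq_zero.1 h
  -- (1') `c ℓ = n⁺_ℓ - n⁻_ℓ` with `n^±_ℓ ≤ 1` the number of `W` / `W^⊥`-members of the pair `ℓ` in the word
  have hcℓ : ∀ ℓ, c ℓ = ((Finset.univ.filter fun t => P t = Sum.inl ℓ ∧ η t = κ ℓ).card : ℤ) -
      ((Finset.univ.filter fun t => P t = Sum.inl ℓ ∧ η t = 1 - κ ℓ).card : ℤ) := by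
    intro ℓ
    rw [hc, Finset.card_filter, Finset.card_filter, Nat.cast_sum, Nat.cast_sum, ← Finset.sum_sub_distrib]
    refine Finset.sum_congr rfl fun t _ => ?_
    rcases hP : P t with ℓ' | e
    · by_cases hℓ : ℓ' = ℓ
      · subst hℓ
        simp only [Sum.elim_inl, if_true, true_and]
        rcases Fin.exists_fin_two.1 ⟨η t, rfl⟩ with h0 | h0 <;>
          rcases Fin.exists_fin_two.1 ⟨κ ℓ', rfl⟩ with k0 | k0 <;> simp [h0, k0]
      · have hne : ¬ (Sum.inl ℓ' : Fin hY ⊕ Fin h) = Sum.inl ℓ := fun h' => hℓ (Sum.inl_injective h')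
        simp [hℓ, hne]
    · simp
  have hn1 : ∀ ℓ, (Finset.univ.filter fun t => P t = Sum.inl ℓ ∧ η t = κ ℓ).card ≤ 1 := fun ℓ =>
    card_filter_place_kind_le_one P η hinj _ _
  have hn2 : ∀ ℓ, (Finset.univ.filter fun t => P t = Sum.inl ℓ ∧ η t = 1 - κ ℓ).card ≤ 1 := fun ℓ =>
    card_filter_place_kind_le_one P η hinj _ _
  -- (2) the `T`-kind weight is `∑_ℓ sgn(κ ℓ) · c ℓ`
  have hKW : ∑ t, Sum.elim (fun _ => if η t = 0 then (1 : ℤ) else -1) (fun _ => (0 : ℤ)) (P t) =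
      ∑ ℓ, (if κ ℓ = 0 then (1 : ℤ) else -1) * c ℓ := by
    have hpt : ∀ t, Sum.elim (fun _ => if η t = 0 then (1 : ℤ) else -1) (fun _ => (0 : ℤ)) (P t) =
        ∑ ℓ, (if κ ℓ = 0 then (1 : ℤ) else -1) *
          Sum.elim (fun ℓ' => if ℓ' = ℓ then (if η t = κ ℓ' then (1 : ℤ) else -1) else 0) (fun _ => (0 : ℤ)) (P t) := by
      intro t
      rcases P t with ℓ₀ | e
      · simp only [Sum.elim_inl, mul_ite, mul_zero, Finset.sum_ite_eq, Finset.mem_univ, if_true]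
        rcases Fin.exists_fin_two.1 ⟨η t, rfl⟩ with h0 | h0 <;>
          rcases Fin.exists_fin_two.1 ⟨κ ℓ₀, rfl⟩ with k0 | k0 <;> simp [h0, k0]
      · simp
    simp only [hpt]
    rw [Finset.sum_comm]
    refine Finset.sum_congr rfl fun ℓ _ => ?_
    rw [← Finset.mul_sum]
  -- (3) the `E`-kind weight `uE` and `Θ`-balance: `KW + uE = 0`
  set uE : ℤ := ∑ t, Sum.elim (fun _ => (0 : ℤ)) (fun _ => if η t = 0 then (1 : ℤ) else -1) (P t) with huE
  have hsumΘ : ∑ t, Sum.elim (fun _ => if η t = 0 then (1 : ℤ) else -1) (fun _ => (0 : ℤ)) (P t) + uE = 0 := by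
    have e : ∑ t, (Sum.elim (fun _ => if η t = 0 then (1 : ℤ) else -1) (fun _ => (0 : ℤ)) (P t) +
        Sum.elim (fun _ => (0 : ℤ)) (fun _ => if η t = 0 then (1 : ℤ) else -1) (P t)) =
        ∑ t, (if η t = 0 then (1 : ℤ) else -1) :=
      Finset.sum_congr rfl fun t _ => by rcases P t with ℓ | e <;> simp
    rw [huE, ← Finset.sum_add_distrib, e]
    exact hΘ
  -- (4) `uE = m₀ - m₁` with `m_r ≤ 1` the number of `E`-letters of kind `r`
  have hcount : ∀ r : Fin 2, (Finset.univ.filter fun t => (∃ e, P t = Sum.inr e) ∧ η t = r).card ≤ 1 := by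
    intro r
    have hle : (Finset.univ.filter fun t => (∃ e, P t = Sum.inr e) ∧ η t = r).card ≤
        ((Finset.univ : Finset (Fin h)).map ⟨(Sum.inr : Fin h → Fin hY ⊕ Fin h), Sum.inr_injective⟩).card := by
      refine Finset.card_le_card_of_injOn P (fun t ht => ?_) (fun t ht t' ht' hPP => ?_)
      · obtain ⟨⟨e, he⟩, -⟩ := (Finset.mem_filter.1 ht).2
        simp [he]
      · have hr := (Finset.mem_filter.1 (Finset.mem_coe.1 ht)).2.2
        have hr' := (Finset.mem_filter.1 (Finset.mem_coe.1 ht')).2.2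
        exact hinj (Prod.ext hPP (hr.trans hr'.symm))
    rw [Finset.card_map, Finset.card_univ, Fintype.card_fin] at hle
    omega
  have huE_eq : uE = ((Finset.univ.filter fun t => (∃ e, P t = Sum.inr e) ∧ η t = 0).card : ℤ) -
      ((Finset.univ.filter fun t => (∃ e, P t = Sum.inr e) ∧ η t = 1).card : ℤ) := by
    rw [huE, Finset.card_filter, Finset.card_filter, Nat.cast_sum, Nat.cast_sum, ← Finset.sum_sub_distrib]
    refine Finset.sum_congr rfl fun t _ => ?_
    rcases hP : P t with ℓ | e
    · simp
    · rcases Fin.exists_fin_two.1 ⟨η t, rfl⟩ with h0 | h1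
      · simp [h0]
      · simp [h1]
  have hm0 := hcount 0
  have hm1 := hcount 1
  -- (5) `∑_ℓ sgn(κ ℓ) = #{κ=0} - #{κ=1} = 1`
  have hsgn : ∑ ℓ, (if κ ℓ = 0 then (1 : ℤ) else -1) = 1 := by
    rw [sum_kindSign_eq_card_sub_card' Finset.univ κ, hκ]; push_cast; ring
  rcases isEmpty_or_nonempty (Fin hY) with hemp | ⟨⟨ℓ₀⟩⟩
  · simp only [Finset.univ_eq_empty, Finset.filter_empty, Finset.card_empty] at hκ
    exact absurd hκ (by omega)
  have hconst : ∀ ℓ, c ℓ = c ℓ₀ := fun ℓ => hcc ℓ ℓ₀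
  have hKW' : ∑ t, Sum.elim (fun _ => if η t = 0 then (1 : ℤ) else -1) (fun _ => (0 : ℤ)) (P t) = c ℓ₀ := by
    rw [hKW]
    calc ∑ ℓ, (if κ ℓ = 0 then (1 : ℤ) else -1) * c ℓ = (∑ ℓ, (if κ ℓ = 0 then (1 : ℤ) else -1)) * c ℓ₀ := by
          rw [Finset.sum_mul]; exact Finset.sum_congr rfl fun ℓ _ => by rw [hconst ℓ]
      _ = c ℓ₀ := by rw [hsgn, one_mul]
  rw [hKW'] at hsumΘ ⊢
  -- the trichotomy on `c ℓ₀ ∈ {-1, 0, 1}`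
  have hc_le : c ℓ₀ ≤ 1 := by
    have := huE_eq; have h0 : (0:ℤ) ≤ ((Finset.univ.filter fun t => (∃ e, P t = Sum.inr e) ∧ η t = 0).card : ℤ) :=
      Nat.cast_nonneg _
    omega
  have hc_ge : -1 ≤ c ℓ₀ := by
    have := huE_eq; have h1 : (0:ℤ) ≤ ((Finset.univ.filter fun t => (∃ e, P t = Sum.inr e) ∧ η t = 1).card : ℤ) :=
      Nat.cast_nonneg _
    omega
  -- letter-level consequences of `c ℓ = ±1` and `uE = ∓1`
  have hpair : ∀ ℓ (r : Fin 2), ((Finset.univ.filter fun t => P t = Sum.inl ℓ ∧ η t = r).card = 1) →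
      ((Finset.univ.filter fun t => P t = Sum.inl ℓ ∧ η t = 1 - r).card = 0) →
      (∀ t, P t = Sum.inl ℓ → η t = r) ∧ (∃ t, P t = Sum.inl ℓ) := by
    intro ℓ r h1 h0
    refine ⟨fun t ht => ?_, ?_⟩
    · by_contra hne
      have hr : η t = 1 - r := fin2_eq_one_sub_of_ne hne
      have hmem : t ∈ Finset.univ.filter fun t => P t = Sum.inl ℓ ∧ η t = 1 - r :=
        Finset.mem_filter.2 ⟨Finset.mem_univ _, ht, hr⟩
      rw [Finset.card_eq_zero] at h0
      rw [h0] at hmem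
      exact absurd hmem (Finset.notMem_empty _)
    · obtain ⟨t, ht⟩ := Finset.card_pos.1 (by omega : 0 < (Finset.univ.filter fun t => P t = Sum.inl ℓ ∧ η t = r).card)
      exact ⟨t, (Finset.mem_filter.1 ht).2.1⟩
  have hE : ∀ r : Fin 2, ((Finset.univ.filter fun t => (∃ e, P t = Sum.inr e) ∧ η t = r).card = 1) →
      ((Finset.univ.filter fun t => (∃ e, P t = Sum.inr e) ∧ η t = 1 - r).card = 0) →
      (∀ t e, P t = Sum.inr e → η t = r) ∧ (∃ t e, P t = Sum.inr e) := by
    intro r h1 h0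
    refine ⟨fun t e ht => ?_, ?_⟩
    · by_contra hne
      have hr : η t = 1 - r := fin2_eq_one_sub_of_ne hne
      have hmem : t ∈ Finset.univ.filter fun t => (∃ e, P t = Sum.inr e) ∧ η t = 1 - r :=
        Finset.mem_filter.2 ⟨Finset.mem_univ _, ⟨e, ht⟩, hr⟩
      rw [Finset.card_eq_zero] at h0
      rw [h0] at hmem
      exact absurd hmem (Finset.notMem_empty _)
    · obtain ⟨t, ht⟩ := Finset.card_pos.1
        (by omega : 0 < (Finset.univ.filter fun t => (∃ e, P t = Sum.inr e) ∧ η t = r).card)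
      obtain ⟨⟨e, he⟩, -⟩ := (Finset.mem_filter.1 ht).2
      exact ⟨t, e, he⟩
  rcases lt_trichotomy (c ℓ₀) 0 with hneg | hzero | hpos
  · -- `c = -1`: the `-`-Weil word
    have hc1 : c ℓ₀ = -1 := by omega
    right; right
    have huE1 : uE = 1 := by omega
    obtain ⟨hEt, hEex⟩ := hE 0 (by have := hcount 0; have := hcount 1; omega)
      (by have := hcount 0; have := hcount 1; simp only [sub_zero]; omega)
    refine ⟨fun t => ?_, fun ℓ => ?_, hEex⟩
    · rcases hP : P t with ℓ | e
      · simp only [Sum.elim_inl]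
        have h := hcℓ ℓ; rw [hconst ℓ, hc1] at h
        have hA := hn1 ℓ; have hB := hn2 ℓ
        obtain ⟨hall, -⟩ := hpair ℓ (1 - κ ℓ) (by omega) (by simp only [sub_sub_cancel]; omega)
        rw [hall t hP]
        exact fin2_one_sub_ne (κ ℓ)
      · simp only [Sum.elim_inr]; exact hEt t e hP
    · have h := hcℓ ℓ; rw [hconst ℓ, hc1] at h
      have hA := hn1 ℓ; have hB := hn2 ℓ
      exact (hpair ℓ (1 - κ ℓ) (by omega) (by simp only [sub_sub_cancel]; omega)).2
  · left; exact hzero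
  · -- `c = 1`: the `+`-Weil word
    have hc1 : c ℓ₀ = 1 := by omega
    right; left
    have huE1 : uE = -1 := by omega
    obtain ⟨hEt, hEex⟩ := hE 1 (by have := hcount 0; have := hcount 1; omega)
      (by have := hcount 0; have := hcount 1; simp only [sub_self]; omega)
    refine ⟨fun t => ?_, fun ℓ => ?_, hEex⟩
    · rcases hP : P t with ℓ | e
      · simp only [Sum.elim_inl]
        have h := hcℓ ℓ; rw [hconst ℓ, hc1] at h
        have hA := hn1 ℓ; have hB := hn2 ℓ
        exact (hpair ℓ (κ ℓ) (by omega) (by omega)).1 t hP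
      · simp only [Sum.elim_inr]; exact hEt t e hP
    · have h := hcℓ ℓ; rw [hconst ℓ, hc1] at h
      have hA := hn1 ℓ; have hB := hn2 ℓ
      exact (hpair ℓ (κ ℓ) (by omega) (by omega)).2

end CombinatoricsTwoOne

/-! ### §2 The invariance theorem for ONE slot over `T × E`, multiplicities `(2,1)` -/

section Invariance

variable {Y E X : AbelianVariety ℂ} {g : Fin 1 → (X ⟶ Y.prod E)}

/-- The two elements of `Fin 2`. [folklore] -/
private theorem fin2_eq_zero_or_one_w (r : Fin 2) : r = 0 ∨ r = 1 := by
  fin_cases r <;> simp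

/-- `(i√d)² = -d` (as the rational `d` cast to `ℂ`). [folklore] -/
private theorem I_mul_sqrt_sq_w (d : ℕ) : (Complex.I * (Real.sqrt d : ℂ)) ^ 2 = -((d : ℚ) : ℂ) := by
  rw [mul_pow, Complex.I_sq, ← Complex.ofReal_pow, Real.sq_sqrt (Nat.cast_nonneg d), Complex.ofReal_natCast,
    Rat.cast_natCast, neg_one_mul]

/-- `conj(i√d) = -i√d`. [folklore] -/
private theorem conj_I_mul_sqrt_w (d : ℕ) :
    starRingEnd ℂ (Complex.I * (Real.sqrt d : ℂ)) = -(Complex.I * (Real.sqrt d : ℂ)) := by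
  rw [map_mul, Complex.conj_I, Complex.conj_ofReal, neg_mul]

/-- `[a]·x - [b]·x = ([a] - [b]) • x` with an integer scalar. [folklore] -/
private theorem ite_sub_ite_eq_cast_smul_w {M : Type*} [AddCommGroup M] [Module ℂ M] (a b : Prop) [Decidable a]
    [Decidable b] (x : M) :
    ((if a then x else 0) - (if b then x else 0)) =
      ((((if a then (1 : ℤ) else 0) - (if b then (1 : ℤ) else 0) : ℤ)) : ℂ) • x := by
  split_ifs <;> simp

set_option maxHeartbeats 800000 in
open scoped Classical in
/-- **The INVARIANCE THEOREM WITH WEIL WORDS for ONE slot over `T × E`, `T` a threefold of unitary type `(2,1)`, `E`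
an elliptic curve with complex multiplication by the SAME `k = ℚ(√-d)` and matching signs** (Moonen–Zarhin 1999 case
(a1), §5 (5.3) / Thm. 0.1 (1): «the Hodge ring `B•(X)` is generated by the subalgebra `D•(X)` of divisor classes
together with the space of Weil classes `W_k ⊂ B²(X)`»; Lie step `Motives/HodgeThetaAnnihilatorUnitaryTimesCMCurve`).
Let `T` (here `Y`) be a complex abelian threefold with `dim_ℚ End⁰(T) = 2`, `φ ≫ φ = -d` (`d > 0`) and multiplicity `1`
at `μ₀ ∈ {i√d, -i√d}`; `E` an elliptic curve with `χ ≫ χ = -d` and multiplicity `1` at the SAME `μ₀` (so that `k`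
acts on `T_{T × E,0}` with multiplicities `(2,2)`); `X` with ONE slot over `T × E`. Then there are Hodge-adapted pair
bases of `H¹(T) ⊗ ℂ` and `H¹(E) ⊗ ℂ`, kinds `κ` of the `T`-pairs, such that: the `κ ℓ`-member of the pair `ℓ` and the
kind-`1` letter of `E` are `μ̄₀`-eigenvectors of `φ^*`, `χ^*`, the other members `μ₀`-eigenvectors, and every rational
`(p,p)`-class on `X` has a letter expansion whose coefficient function VANISHES at every word which is neither
`T`-kind balanced NOR a `±`-Weil word without repeated letters (`+`: every `T`-letter the `κ`-member of its pair, every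
pair present, the `E`-letter of kind `1` present and no other; `-`: the mirror). Proof: R29's proof
(`UnitaryTypeOneTimesCMCurveProductSpan` §3) verbatim up to the root-difference weights, then
`kindWeight_eq_zero_or_weilWord_of_rootDiffWeights`.
[cite: MoonenZarhin1999LowDim, Thm. 0.1 (1) with case (a) and §5 (5.3)] [cite: MoonenZarhin1999LowDim, §2 (2.3) and §3 (3.1)]
[cite: Deligne1982HodgeCycles, I §3 Prop. 3.4] [cite: Lombardo2016, Lemma 3.4 (p. 1229)] [cite: Ribet1983, Thm. 3] -/
theorem AVSlots.exists_coeff_eq_zero_off_balanced_or_weilWord_of_prod_unitaryTwoOne_cmCurve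
    (hg : AVSlots (Y.prod E) X g)
    (hY3 : Y.dim = 3) (hY2 : Module.finrank ℚ Y.endAlgebra = 2) (φY : Y ⟶ Y) {d : ℕ} (hd : 0 < d)
    (hφY : φY ≫ φY = -(d • 𝟙 Y)) {μ₀ : ℂ}
    (hμ₀ : μ₀ = Complex.I * (Real.sqrt d : ℂ) ∨ μ₀ = -(Complex.I * (Real.sqrt d : ℂ)))
    (hmY : eigenMultiplicity Y φY μ₀ = 1)
    (hE1 : E.dim = 1) (χ : E ⟶ E) (hχ : χ ≫ χ = -(d • 𝟙 E)) (hmE : eigenMultiplicity E χ μ₀ = 1) :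
    ∃ (hA : ℕ) (bA : Module.Basis (Fin hA × Fin 2) ℂ (ℂ ⊗[ℚ] bettiCohomology Y.X 1))
      (h : ℕ) (cC : Module.Basis (Fin h × Fin 2) ℂ (ℂ ⊗[ℚ] bettiCohomology E.X 1)) (κ : Fin hA → Fin 2),
      (∀ i, IsOfHodgeType Y.dim Y.X 1 1 0 (ofRatClassBaseChange (Motives.ComplexPoints Y.X) 1 (bA (i, 0)))) ∧
      (∀ i, IsOfHodgeType Y.dim Y.X 1 0 1 (ofRatClassBaseChange (Motives.ComplexPoints Y.X) 1 (bA (i, 1)))) ∧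
      (∀ i, IsOfHodgeType E.dim E.X 1 1 0 (ofRatClassBaseChange (Motives.ComplexPoints E.X) 1 (cC (i, 0)))) ∧
      (∀ i, IsOfHodgeType E.dim E.X 1 0 1 (ofRatClassBaseChange (Motives.ComplexPoints E.X) 1 (cC (i, 1)))) ∧
      (∀ ℓ r, ofRatClassBaseChange (Motives.ComplexPoints Y.X) 1 (bA (ℓ, r)) ∈
        Module.End.eigenspace (complexBetti.map φY.hom.hom.hom 1).hom (if r = κ ℓ then starRingEnd ℂ μ₀ else μ₀)) ∧
      (∀ i r, ofRatClassBaseChange (Motives.ComplexPoints E.X) 1 (cC (i, r)) ∈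
        Module.End.eigenspace (complexBetti.map χ.hom.hom.hom 1).hom (if r = 1 then starRingEnd ℂ μ₀ else μ₀)) ∧
      ∀ {p : ℕ}, 0 < p → ∀ {c : complexBetti X.X (2 * p)}, IsRationalClass c →
        IsOfHodgeType X.dim X.X (2 * p) p p c →
        ∃ a : (Fin (2 * p) → (Fin 1 × (Fin hA ⊕ Fin h)) × Fin 2) → ℂ,
          wordEval (cupPowOneAlt ℂ (Motives.ComplexPoints X.X) (2 * p))
            (fun jr : (Fin 1 × (Fin hA ⊕ Fin h)) × Fin 2 => complexBetti.map (g jr.1.1).hom.hom.hom 1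
              (Sum.elim
                (fun i => complexBetti.map (Motives.AbelianVariety.fst Y E).hom.hom.hom 1
                  (ofRatClassBaseChange (Motives.ComplexPoints Y.X) 1 (bA (i, jr.2))))
                (fun i => complexBetti.map (Motives.AbelianVariety.snd Y E).hom.hom.hom 1
                  (ofRatClassBaseChange (Motives.ComplexPoints E.X) 1 (cC (i, jr.2))))
                jr.1.2)) a = c ∧
          ∀ (U : Fin (2 * p) → Fin 1 × (Fin hA ⊕ Fin h)) (η : Fin (2 * p) → Fin 2),
            a (fun t => (U t, η t)) ≠ 0 →
            Function.Injective (fun t => ((U t).2, η t)) ∧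
            ((∑ t, Sum.elim (fun _ : Fin hA => if η t = 0 then (1 : ℤ) else -1) (fun _ : Fin h => (0 : ℤ)) (U t).2 = 0) ∨
             ((∀ t, Sum.elim (fun ℓ => η t = κ ℓ) (fun _ => η t = 1) (U t).2) ∧ (∀ ℓ, ∃ t, (U t).2 = Sum.inl ℓ) ∧
               (∃ t e, (U t).2 = Sum.inr e)) ∨
             ((∀ t, Sum.elim (fun ℓ => η t ≠ κ ℓ) (fun _ => η t = 0) (U t).2) ∧ (∀ ℓ, ∃ t, (U t).2 = Sum.inl ℓ) ∧
               (∃ t e, (U t).2 = Sum.inr e))) := by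
  classical
  -- the setting
  have hHD : exists_isReal_hodgeModel := exists_isReal_hodgeModel_holds
  have hI : hodgePQ_independent_of_hodgeModel := hodgePQ_independent_of_hodgeModel_holds
  haveI : HodgeTensorFacts.{0, 0} := hodgeTensorFacts_holds.{0, 0}
  have hXA : IsSmoothProjective Y.dim Y.X := AbelianVariety.isSmoothProjective_holds
  have hXC : IsSmoothProjective E.dim E.X := AbelianVariety.isSmoothProjective_holds
  have hXP : IsSmoothProjective (Y.prod E).dim (Y.prod E).X := AbelianVariety.isSmoothProjective_holds
  haveI : Module.Finite ℚ (bettiCohomology Y.X 1) := finite_bettiCohomology_one Y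
  haveI : Module.Finite ℚ (bettiCohomology E.X 1) := finite_bettiCohomology_one E
  haveI : Module.Finite ℚ (bettiCohomology (Y.prod E).X 1) := finite_bettiCohomology_one (Y.prod E)
  have hn1 : (((1 : ℕ) : ℤ)) = 1 := by norm_num
  have heffA := BettiUniverse.hodge_isEffective hHD hXA 1
  -- polarizations of `H¹(Y)`, `H¹(E)`
  obtain ⟨ψ⟩ : (BettiUniverse.hodge hHD (AbelianVariety.isSmoothProjective_holds (A := Y)) 1).IsPolarizable :=
    smoothProjective_hodgeStructure_isPolarizable_holds hXA (BettiUniverse.realHodgeModel hHD hXA)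
      (BettiUniverse.realHodgeModel_isHodgeSymmetric hHD hXA) 1
  obtain ⟨ψC⟩ : (BettiUniverse.hodge hHD (AbelianVariety.isSmoothProjective_holds (A := E)) 1).IsPolarizable :=
    smoothProjective_hodgeStructure_isPolarizable_holds hXC (BettiUniverse.realHodgeModel hHD hXC)
      (BettiUniverse.realHodgeModel_isHodgeSymmetric hHD hXC) 1
  -- the unitary data of `H¹(Y)`: `φ^*`, `End_Hdg = ℚ + ℚφ^*`, `μ` with `n''(μ) = 1`, `n'(μ) ≥ 2`
  set φQ : Module.End ℚ (bettiCohomology Y.X 1) := (bettiCohomology.map φY.hom.hom.hom 1).hom with hφQ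
  have hφE : φQ ∈ (BettiUniverse.hodge hHD (AbelianVariety.isSmoothProjective_holds (A := Y)) 1).endAlg :=
    pullback_mem_endAlg hHD hI φY
  have hφ2 : φQ * φQ = -((d : ℚ) • 1) := bettiMapHom_mul_self hφY
  have hdQ : (0 : ℚ) < d := Nat.cast_pos.2 hd
  have hE := exists_eq_smul_one_add_smul_bettiMapHom hHD hI hd hφY hY2 (by omega)
  have hsumm := eigenMultiplicity_add_eigenMultiplicity_neg_eq_dim Y φY hd hφY
  -- `μ := μ̄₀ = -μ₀`: multiplicity `1` on `H^{0,1}`, `2` on `H^{1,0}`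
  set μ : ℂ := starRingEnd ℂ μ₀ with hμdef
  have hμ0' : starRingEnd ℂ μ₀ = -μ₀ := by
    rcases hμ₀ with h | h
    · rw [h, conj_I_mul_sqrt_w]
    · rw [h, map_neg, conj_I_mul_sqrt_w]
  have hμconj : starRingEnd ℂ μ = μ₀ := by rw [hμdef, Complex.conj_conj]
  have hμ : μ ^ 2 = -((d : ℚ) : ℂ) := by
    rw [hμdef, hμ0', neg_sq]
    rcases hμ₀ with h | h
    · rw [h, I_mul_sqrt_sq_w]
    · rw [h, neg_sq, I_mul_sqrt_sq_w]
  have hmult1 : eigenMultiplicity Y φY (starRingEnd ℂ μ) = 1 := by rw [hμconj, hmY]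
  have hmult2' : eigenMultiplicity Y φY μ = 2 := by
    rw [hμdef, hμ0']
    rcases hμ₀ with h | h
    · rw [h] at hmY ⊢; omega
    · rw [h] at hmY; rw [h, neg_neg]; omega
  have hmult2 : 2 ≤ eigenMultiplicity Y φY μ := hmult2'.ge
  have h1' : Module.finrank ℂ ↥(Module.End.eigenspace (φQ.baseChange ℂ) μ ⊓
      (BettiUniverse.hodge hHD (AbelianVariety.isSmoothProjective_holds (A := Y)) 1).piece 0 1) = 1 := by
    rw [hφQ, finrank_eigenspace_inf_piece_zeroOne_eq_eigenMultiplicity_conj hHD hI φY μ, hmult1]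
  have h2' : 2 ≤ Module.finrank ℂ ↥(Module.End.eigenspace (φQ.baseChange ℂ) μ ⊓
      (BettiUniverse.hodge hHD (AbelianVariety.isSmoothProjective_holds (A := Y)) 1).piece 1 0) := by
    rw [hφQ, finrank_eigenspace_inf_piece_oneZero_eq_eigenMultiplicity hHD hI φY μ]
    exact hmult2
  have h2eq : Module.finrank ℂ ↥(Module.End.eigenspace (φQ.baseChange ℂ) μ ⊓
      (BettiUniverse.hodge hHD (AbelianVariety.isSmoothProjective_holds (A := Y)) 1).piece 1 0) = 2 := by
    rw [hφQ, finrank_eigenspace_inf_piece_oneZero_eq_eigenMultiplicity hHD hI φY μ, hmult2']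
  obtain ⟨hμ0, -⟩ := UnitaryTheta.conj_eq_neg_of_sq hdQ hμ
  -- adapted `ψ_ℂ`-dual bases `(e_ℓ, f_ℓ) = (cb (0,ℓ), cb (1,ℓ))` of `H¹(Y) ⊗ ℂ = W ⊕ W'`, kinds `κ`
  obtain ⟨n₀, cb, κ, hcbW, hcbW', hcb0, hcb1, hdual⟩ := UnitaryTheta.exists_adaptedDualBasis
    (BettiUniverse.hodge hHD (AbelianVariety.isSmoothProjective_holds (A := Y)) 1) Nat.cast_one heffA ψ hφE
    hdQ hφ2 hE hμ
  -- the same basis in PAIR format: `bY (ℓ, r) = cb (if r = κ ℓ then 0 else 1, ℓ)` (`r` = the Hodge kind)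
  set τ : Fin n₀ × Fin 2 ≃ Fin 2 × Fin n₀ :=
    { toFun := fun lr => (if lr.2 = κ lr.1 then 0 else 1, lr.1)
      invFun := fun tl => (tl.2, if tl.1 = 0 then κ tl.2 else (if κ tl.2 = 0 then 1 else 0))
      left_inv := by
        rintro ⟨ℓ, r⟩
        rcases fin2_eq_zero_or_one_w r with hr | hr <;>
          rcases fin2_eq_zero_or_one_w (κ ℓ) with hk | hk <;> simp [hr, hk]
      right_inv := by
        rintro ⟨t, ℓ⟩
        rcases fin2_eq_zero_or_one_w t with ht | ht <;>
          rcases fin2_eq_zero_or_one_w (κ ℓ) with hk | hk <;> simp [ht, hk] } with hτ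
  set bY : Module.Basis (Fin n₀ × Fin 2) ℂ (ℂ ⊗[ℚ] bettiCohomology Y.X 1) := cb.reindex τ.symm with hbYdef
  have hbY : ∀ ℓ r, bY (ℓ, r) = cb (if r = κ ℓ then 0 else 1, ℓ) := fun ℓ r => by
    rw [hbYdef, Module.Basis.reindex_apply, Equiv.symm_symm]
    rfl
  have hbY0' : ∀ ℓ, bY (ℓ, 0) ∈ (BettiUniverse.hodge hHD hXA 1).piece 1 0 := by
    intro ℓ
    rw [hbY]
    rcases fin2_eq_zero_or_one_w (κ ℓ) with hk | hk
    · rw [hk, if_pos rfl]; exact (hcb0 ℓ hk).1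
    · rw [hk, if_neg (by decide)]; exact (hcb1 ℓ hk).2
  have hbY1' : ∀ ℓ, bY (ℓ, 1) ∈ (BettiUniverse.hodge hHD hXA 1).piece 0 1 := by
    intro ℓ
    rw [hbY]
    rcases fin2_eq_zero_or_one_w (κ ℓ) with hk | hk
    · rw [hk, if_neg (by decide)]; exact (hcb0 ℓ hk).2
    · rw [hk, if_pos rfl]; exact (hcb1 ℓ hk).1
  -- the pair basis of `H¹(E) ⊗ ℂ`
  obtain ⟨h, cC, hcC0, hcC1⟩ := exists_hodgeAdapted_pairBasis (BettiUniverse.hodge hHD hXC 1) (by norm_num)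
    (BettiUniverse.hodge_isEffective hHD hXC 1)
  have hcC0' : ∀ i, cC (i, 0) ∈ (BettiUniverse.hodge hHD hXC 1).piece 1 0 := fun i => by simpa using hcC0 i
  have hcC1' : ∀ i, cC (i, 1) ∈ (BettiUniverse.hodge hHD hXC 1).piece 0 1 := fun i => by simpa using hcC1 i
  -- COUNTS: `h = 1` (`dim E = 1`), `n₀ = dim Y = 3`, `#{κ = 1} ≤ 1`, `#{κ = 0} ≤ 2`, hence `#{κ = 0} = #{κ = 1} + 1`
  have hh1 : h = 1 := by
    have hcard := Module.finrank_eq_card_basis cC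
    rw [Module.finrank_baseChange, finrank_bettiCohomology_one E, hE1, Fintype.card_prod, Fintype.card_fin,
      Fintype.card_fin] at hcard
    omega
  have hn₀ : n₀ = Y.dim := by
    have hcard := Module.finrank_eq_card_basis cb
    rw [Module.finrank_baseChange, finrank_bettiCohomology_one Y, Fintype.card_prod, Fintype.card_fin,
      Fintype.card_fin] at hcard
    omega
  have hκ1 : (Finset.univ.filter fun ℓ => κ ℓ = 1).card ≤ 1 := by
    set S := Module.End.eigenspace (φQ.baseChange ℂ) μ ⊓
      (BettiUniverse.hodge hHD (AbelianVariety.isSmoothProjective_holds (A := Y)) 1).piece 0 1 with hS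
    set f : {ℓ : Fin n₀ // κ ℓ = 1} → ↥S := fun ℓ => ⟨cb (0, ℓ.1), hcbW ℓ.1, (hcb1 ℓ.1 ℓ.2).1⟩ with hf
    have hli : LinearIndependent ℂ f := by
      refine LinearIndependent.of_comp S.subtype ?_
      have hcomp : ⇑S.subtype ∘ f = ⇑cb ∘ fun ℓ : {ℓ : Fin n₀ // κ ℓ = 1} => ((0 : Fin 2), ℓ.1) := by
        funext ℓ; rfl
      rw [hcomp]
      exact cb.linearIndependent.comp _ fun ℓ ℓ' hll => Subtype.ext (Prod.mk.inj hll).2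
    have hle := hli.fintype_card_le_finrank
    rw [Fintype.card_subtype, h1'] at hle
    exact hle
  have hκ0 : (Finset.univ.filter fun ℓ => κ ℓ = 0).card ≤ 2 := by
    set S := Module.End.eigenspace (φQ.baseChange ℂ) μ ⊓
      (BettiUniverse.hodge hHD (AbelianVariety.isSmoothProjective_holds (A := Y)) 1).piece 1 0 with hS
    set f : {ℓ : Fin n₀ // κ ℓ = 0} → ↥S := fun ℓ => ⟨cb (0, ℓ.1), hcbW ℓ.1, (hcb0 ℓ.1 ℓ.2).1⟩ with hf
    have hli : LinearIndependent ℂ f := by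
      refine LinearIndependent.of_comp S.subtype ?_
      have hcomp : ⇑S.subtype ∘ f = ⇑cb ∘ fun ℓ : {ℓ : Fin n₀ // κ ℓ = 0} => ((0 : Fin 2), ℓ.1) := by
        funext ℓ; rfl
      rw [hcomp]
      exact cb.linearIndependent.comp _ fun ℓ ℓ' hll => Subtype.ext (Prod.mk.inj hll).2
    have hle := hli.fintype_card_le_finrank
    rw [Fintype.card_subtype, h2eq] at hle
    exact hle
  have hκsum : (Finset.univ.filter fun ℓ => κ ℓ = 0).card + (Finset.univ.filter fun ℓ => κ ℓ = 1).card = n₀ := by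
    have hneg : (Finset.univ.filter fun ℓ => ¬ κ ℓ = 0) = (Finset.univ.filter fun ℓ => κ ℓ = 1) := by
      refine Finset.filter_congr fun ℓ _ => ?_
      rcases fin2_eq_zero_or_one_w (κ ℓ) with hk | hk <;> simp [hk]
    rw [← hneg, Finset.card_filter_add_card_filter_not, Finset.card_univ, Fintype.card_fin]
  have hκ : (Finset.univ.filter fun ℓ => κ ℓ = 0).card = (Finset.univ.filter fun ℓ => κ ℓ = 1).card + 1 := by
    omega
  -- EIGEN-LETTERS of `E`: the Hodge pieces of `H¹(E)` are lines, so `c_0^0 ∈ V_{μ₀}(χ)`, `c_0^1 ∈ V_{μ̄₀}(χ)`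
  set χQ : Module.End ℚ (bettiCohomology E.X 1) := (bettiCohomology.map χ.hom.hom.hom 1).hom with hχQ
  have hdisjE : Disjoint ((BettiUniverse.hodge hHD hXC 1).piece 1 0) ((BettiUniverse.hodge hHD hXC 1).piece 0 1) := by
    have h := (iSupIndep_piece_holds (BettiUniverse.hodge hHD hXC 1)).pairwiseDisjoint (show (1 : ℤ) ≠ 0 by norm_num)
    simp only [Function.onFun, Nat.cast_one, sub_self, sub_zero] at h
    exact h
  have hh0 : ∀ i : Fin h, i = ⟨0, by omega⟩ := fun i => Fin.ext (by have := i.2; omega)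
  -- a nonzero vector of a line through `cC (i, r)` inside the piece forces `cC (i, r)` into the eigenspace
  have hlineE : ∀ (r : Fin 2) (c : ℂ) (p q : ℤ), (p = 1 ∧ q = 0 ∧ r = 0) ∨ (p = 0 ∧ q = 1 ∧ r = 1) →
      Module.finrank ℂ ↥(Module.End.eigenspace (χQ.baseChange ℂ) c ⊓ (BettiUniverse.hodge hHD hXC 1).piece p q) = 1 →
      ∀ i, cC (i, r) ∈ Module.End.eigenspace (χQ.baseChange ℂ) c := by
    intro r c p q hpq hfin i
    have hne : Module.End.eigenspace (χQ.baseChange ℂ) c ⊓ (BettiUniverse.hodge hHD hXC 1).piece p q ≠ ⊥ := by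
      intro hbot
      rw [hbot, finrank_bot] at hfin
      exact zero_ne_one hfin
    obtain ⟨v, hv, hv0⟩ := Submodule.exists_mem_ne_zero_of_ne_bot hne
    -- expand `v` in the basis `cC`: `v = α • cC (0,0) + β • cC (0,1)`
    have hvsum : v = cC.repr v (⟨0, by omega⟩, 0) • cC (⟨0, by omega⟩, 0) +
        cC.repr v (⟨0, by omega⟩, 1) • cC (⟨0, by omega⟩, 1) := by
      conv_lhs => rw [← cC.sum_repr v]
      rw [Fintype.sum_prod_type, Fintype.sum_eq_single (⟨0, by omega⟩ : Fin h) (fun i hi => absurd (hh0 i) hi),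
        Fin.sum_univ_two]
    set α : ℂ := cC.repr v (⟨0, by omega⟩, 0) with hαdef
    set β : ℂ := cC.repr v (⟨0, by omega⟩, 1) with hβdef
    have hi0 : i = ⟨0, by omega⟩ := hh0 i
    subst hi0
    rcases hpq with ⟨rfl, rfl, rfl⟩ | ⟨rfl, rfl, rfl⟩
    · -- `β • cC (0,1) = v - α • cC (0,0) ∈ piece 1 0 ∩ piece 0 1 = 0`
      have hβ : β • cC (⟨0, by omega⟩, 1) = 0 := by
        refine (Submodule.disjoint_def.1 hdisjE) _ ?_ (Submodule.smul_mem _ _ (hcC1' _))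
        have e : β • cC (⟨0, by omega⟩, 1) = v - α • cC (⟨0, by omega⟩, 0) := by
          rw [eq_sub_iff_add_eq, add_comm, ← hvsum]
        rw [e]
        exact Submodule.sub_mem _ hv.2 (Submodule.smul_mem _ _ (hcC0' _))
      have hα : α ≠ 0 := by
        intro h0
        rw [h0, zero_smul, zero_add] at hvsum
        rw [← hvsum] at hβ
        exact hv0 hβ
      have hv' : v = α • cC (⟨0, by omega⟩, 0) := by rw [hvsum, hβ, add_zero]
      have : cC (⟨0, by omega⟩, 0) = α⁻¹ • v := by
        rw [hv', smul_smul, inv_mul_cancel₀ hα, one_smul]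
      rw [this]
      exact Submodule.smul_mem _ _ hv.1
    · have hα : α • cC (⟨0, by omega⟩, 0) = 0 := by
        refine (Submodule.disjoint_def.1 hdisjE) _ (Submodule.smul_mem _ _ (hcC0' _)) ?_
        have e : α • cC (⟨0, by omega⟩, 0) = v - β • cC (⟨0, by omega⟩, 1) := by
          rw [eq_sub_iff_add_eq, ← hvsum]
        rw [e]
        exact Submodule.sub_mem _ hv.2 (Submodule.smul_mem _ _ (hcC1' _))
      have hβ : β ≠ 0 := by
        intro h0
        rw [h0, zero_smul, add_zero] at hvsum
        rw [← hvsum] at hα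
        exact hv0 hα
      have hv' : v = β • cC (⟨0, by omega⟩, 1) := by rw [hvsum, hα, zero_add]
      have : cC (⟨0, by omega⟩, 1) = β⁻¹ • v := by
        rw [hv', smul_smul, inv_mul_cancel₀ hβ, one_smul]
      rw [this]
      exact Submodule.smul_mem _ _ hv.1
  have hcCμ0 : ∀ i, cC (i, 0) ∈ Module.End.eigenspace (χQ.baseChange ℂ) μ₀ :=
    hlineE 0 μ₀ 1 0 (Or.inl ⟨rfl, rfl, rfl⟩)
      (by rw [hχQ, finrank_eigenspace_inf_piece_oneZero_eq_eigenMultiplicity hHD hI χ μ₀, hmE])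
  have hcCμ1 : ∀ i, cC (i, 1) ∈ Module.End.eigenspace (χQ.baseChange ℂ) μ :=
    hlineE 1 μ 0 1 (Or.inr ⟨rfl, rfl, rfl⟩)
      (by rw [hχQ, finrank_eigenspace_inf_piece_zeroOne_eq_eigenMultiplicity_conj hHD hI χ μ, hμconj, hmE])
  -- transport of eigenvectors along `ρ : H¹(·; ℚ) ⊗ ℂ ≅ H¹(·(ℂ); ℂ)`
  have hρY : ∀ (x : ℂ ⊗[ℚ] bettiCohomology Y.X 1) (c : ℂ), x ∈ Module.End.eigenspace (φQ.baseChange ℂ) c →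
      ofRatClassBaseChange (Motives.ComplexPoints Y.X) 1 x ∈
        Module.End.eigenspace (complexBetti.map φY.hom.hom.hom 1).hom c := by
    intro x c hx
    rw [Module.End.mem_eigenspace_iff] at hx ⊢
    have h := congrArg (ofRatClassBaseChange (Motives.ComplexPoints Y.X) 1) hx
    rw [map_smul, hφQ, ofRatClassBaseChange_baseChange_bettiMapHom] at h
    exact h
  have hρE : ∀ (x : ℂ ⊗[ℚ] bettiCohomology E.X 1) (c : ℂ), x ∈ Module.End.eigenspace (χQ.baseChange ℂ) c →
      ofRatClassBaseChange (Motives.ComplexPoints E.X) 1 x ∈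
        Module.End.eigenspace (complexBetti.map χ.hom.hom.hom 1).hom c := by
    intro x c hx
    rw [Module.End.mem_eigenspace_iff] at hx ⊢
    have h := congrArg (ofRatClassBaseChange (Motives.ComplexPoints E.X) 1) hx
    rw [map_smul, hχQ, ofRatClassBaseChange_baseChange_bettiMapHom] at h
    exact h
  refine ⟨n₀, bY, h, cC, κ, fun i => ?_, fun i => ?_, fun i => ?_, fun i => ?_, fun ℓ r => ?_, fun i r => ?_, ?_⟩
  · exact (BettiUniverse.mem_hodge_piece_iff hHD hI hXA (k := 1) (p := 1) (q := 0) rfl _).1 (hbY0' i)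
  · exact (BettiUniverse.mem_hodge_piece_iff hHD hI hXA (k := 1) (p := 0) (q := 1) rfl _).1 (hbY1' i)
  · exact (BettiUniverse.mem_hodge_piece_iff hHD hI hXC (k := 1) (p := 1) (q := 0) rfl _).1 (hcC0' i)
  · exact (BettiUniverse.mem_hodge_piece_iff hHD hI hXC (k := 1) (p := 0) (q := 1) rfl _).1 (hcC1' i)
  · refine hρY _ _ ?_
    rw [hbY]
    by_cases hr : r = κ ℓ
    · rw [if_pos hr, if_pos hr]; exact hcbW ℓ
    · have hnegμ : -μ = μ₀ := by rw [hμdef, hμ0', neg_neg]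
      rw [if_neg hr, if_neg hr, ← hnegμ]; exact hcbW' ℓ
  · refine hρE _ _ ?_
    rcases fin2_eq_zero_or_one_w r with hr | hr
    · rw [hr, if_neg (by decide)]; exact hcCμ0 i
    · rw [hr, if_pos rfl]; exact hcCμ1 i
  intro p hp c hcQ hc
  -- the presentation `H¹(Y × E) = pr_Y^* H¹(Y) ⊕ pr_E^* H¹(E)` and its complexification
  set ι₁ := HOneProduct.pullFst Y E with hι₁
  set π₁ := HOneProduct.pullInl Y E with hπ₁
  set ι₂ := HOneProduct.pullSnd Y E with hι₂
  set π₂ := HOneProduct.pullInr Y E with hπ₂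
  have hπι₁ : π₁ ∘ₗ ι₁ = LinearMap.id := HOneProduct.pullInl_comp_pullFst
  have hπι₂ : π₂ ∘ₗ ι₂ = LinearMap.id := HOneProduct.pullInr_comp_pullSnd
  have hπ₁ι₂ : π₁ ∘ₗ ι₂ = 0 := HOneProduct.pullInl_comp_pullSnd
  have hπ₂ι₁ : π₂ ∘ₗ ι₁ = 0 := HOneProduct.pullInr_comp_pullFst
  have hsum : ι₁ ∘ₗ π₁ + ι₂ ∘ₗ π₂ = LinearMap.id := HOneProduct.pullFst_comp_pullInl_add
  have hπι₁C : π₁.baseChange ℂ ∘ₗ ι₁.baseChange ℂ = LinearMap.id := by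
    rw [← LinearMap.baseChange_comp, hπι₁, LinearMap.baseChange_id]
  have hπι₂C : π₂.baseChange ℂ ∘ₗ ι₂.baseChange ℂ = LinearMap.id := by
    rw [← LinearMap.baseChange_comp, hπι₂, LinearMap.baseChange_id]
  have hπ₁ι₂C : π₁.baseChange ℂ ∘ₗ ι₂.baseChange ℂ = 0 := by
    rw [← LinearMap.baseChange_comp, hπ₁ι₂, LinearMap.baseChange_zero]
  have hπ₂ι₁C : π₂.baseChange ℂ ∘ₗ ι₁.baseChange ℂ = 0 := by
    rw [← LinearMap.baseChange_comp, hπ₂ι₁, LinearMap.baseChange_zero]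
  have hsumC : ι₁.baseChange ℂ ∘ₗ π₁.baseChange ℂ + ι₂.baseChange ℂ ∘ₗ π₂.baseChange ℂ = LinearMap.id := by
    rw [← LinearMap.baseChange_comp, ← LinearMap.baseChange_comp, ← LinearMap.baseChange_add, hsum,
      LinearMap.baseChange_id]
  have e11 : ∀ x, π₁.baseChange ℂ (ι₁.baseChange ℂ x) = x := fun x => by
    rw [← LinearMap.comp_apply (f := π₁.baseChange ℂ), hπι₁C, LinearMap.id_apply]
  have e12 : ∀ y, π₁.baseChange ℂ (ι₂.baseChange ℂ y) = 0 := fun y => by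
    rw [← LinearMap.comp_apply (f := π₁.baseChange ℂ), hπ₁ι₂C, LinearMap.zero_apply]
  -- piece compatibility of `pr_Y^*`, `pr_E^*`
  have hι₁F : ∀ q : ℤ, ∀ x ∈ (BettiUniverse.hodge hHD hXA 1).piece q (((1 : ℕ) : ℤ) - q),
      ι₁.baseChange ℂ x ∈ (BettiUniverse.hodge hHD hXP 1).piece q (((1 : ℕ) : ℤ) - q) :=
    fun q x hx => (BettiUniverse.pullHodgeHom hHD hI hXP hXA (Motives.AbelianVariety.fst Y E).hom.hom.hom 1).map_piece_le
      q _ ⟨x, hx, rfl⟩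
  have hι₂F : ∀ q : ℤ, ∀ x ∈ (BettiUniverse.hodge hHD hXC 1).piece q (((1 : ℕ) : ℤ) - q),
      ι₂.baseChange ℂ x ∈ (BettiUniverse.hodge hHD hXP 1).piece q (((1 : ℕ) : ℤ) - q) :=
    fun q x hx => (BettiUniverse.pullHodgeHom hHD hI hXP hXC (Motives.AbelianVariety.snd Y E).hom.hom.hom 1).map_piece_le
      q _ ⟨x, hx, rfl⟩
  -- the basis `cbx` of `H¹(Y × E) ⊗ ℂ` in pairs: `pr_Y^* bY_ℓ^r` and `pr_E^* c_i^r`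
  obtain ⟨cbx', hcbx'l, hcbx'r⟩ := exists_basis_of_presentation hπι₁C hπι₂C hπ₁ι₂C hπ₂ι₁C hsumC bY cC
  set cbx : Module.Basis ((Fin n₀ ⊕ Fin h) × Fin 2) ℂ (ℂ ⊗[ℚ] bettiCohomology (Y.prod E).X 1) :=
    cbx'.reindex (Equiv.sumProdDistrib (Fin n₀) (Fin h) (Fin 2)).symm with hcbxdef
  have hcbx : ∀ tr : (Fin n₀ ⊕ Fin h) × Fin 2, cbx tr =
      Sum.elim (fun i => ι₁.baseChange ℂ (bY (i, tr.2))) (fun i => ι₂.baseChange ℂ (cC (i, tr.2))) tr.1 := by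
    rintro ⟨t, r⟩
    rw [hcbxdef, Module.Basis.reindex_apply, Equiv.symm_symm]
    rcases t with i | i
    · rw [Equiv.sumProdDistrib_apply_left, hcbx'l]; rfl
    · rw [Equiv.sumProdDistrib_apply_right, hcbx'r]; rfl
  -- Hodge-adaptedness of `cbx`
  have hcbx0 : ∀ t, cbx (t, 0) ∈ (BettiUniverse.hodge hHD hXP 1).piece 1 0 := by
    intro t
    rw [hcbx]
    rcases t with i | i
    · have e : (((1 : ℕ) : ℤ) - 1) = 0 := by norm_num
      have h10 := hι₁F 1 _ (by rw [e]; exact hbY0' i)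
      rwa [e] at h10
    · have e : (((1 : ℕ) : ℤ) - 1) = 0 := by norm_num
      have h10 := hι₂F 1 _ (by rw [e]; exact hcC0' i)
      rwa [e] at h10
  have hcbx1 : ∀ t, cbx (t, 1) ∈ (BettiUniverse.hodge hHD hXP 1).piece 0 1 := by
    intro t
    rw [hcbx]
    rcases t with i | i
    · have e : (((1 : ℕ) : ℤ) - 0) = 1 := by norm_num
      have h01 := hι₁F 0 _ (by rw [e]; exact hbY1' i)
      rwa [e] at h01
    · have e : (((1 : ℕ) : ℤ) - 0) = 1 := by norm_num
      have h01 := hι₂F 0 _ (by rw [e]; exact hcC1' i)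
      rwa [e] at h01
  -- bases indexed by `Fin M`: the pair basis `cbσ` and the rational basis `eC`
  set eQ := Module.finBasis ℚ (bettiCohomology (Y.prod E).X 1) with heQ
  set eC : Module.Basis (Fin (Module.finrank ℚ (bettiCohomology (Y.prod E).X 1))) ℂ
    (ℂ ⊗[ℚ] bettiCohomology (Y.prod E).X 1) := Algebra.TensorProduct.basis ℂ eQ with heC
  set φ : Fin (Module.finrank ℚ (bettiCohomology (Y.prod E).X 1)) ≃ (Fin n₀ ⊕ Fin h) × Fin 2 :=
    eC.indexEquiv cbx with hφ
  set cbσ : Module.Basis (Fin (Module.finrank ℚ (bettiCohomology (Y.prod E).X 1))) ℂ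
    (ℂ ⊗[ℚ] bettiCohomology (Y.prod E).X 1) := cbx.reindex φ.symm with hcbσdef
  have hcbσ : ∀ m, cbσ m = cbx (φ m) := fun m => by
    rw [hcbσdef, Module.Basis.reindex_apply, Equiv.symm_symm]
  -- letters
  set ρ := ofRatClassBaseChangeEquiv hXP 1 with hρ
  set v : Module.Basis _ ℂ (complexBetti (Y.prod E).X 1) := cbσ.map ρ with hv
  set eL : Module.Basis _ ℂ (complexBetti (Y.prod E).X 1) := eC.map ρ with heL
  have heLQ : ∀ i, IsRationalClass (eL i) := fun i => by
    rw [heL, Module.Basis.map_apply, heC, Algebra.TensorProduct.basis_apply, hρ,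
      ofRatClassBaseChangeEquiv_apply, ofRatClassBaseChange_tmul, one_smul]
    exact isRationalClass_ofRatClass _
  set κ' : Fin (Module.finrank ℚ (bettiCohomology (Y.prod E).X 1)) → Fin 2 := fun m => (φ m).2 with hκ'
  have hv_apply : ∀ m, v m = ofRatClassBaseChange (Motives.ComplexPoints (Y.prod E).X) 1 (cbx (φ m)) := fun m => by
    rw [hv, Module.Basis.map_apply, hcbσ, hρ, ofRatClassBaseChangeEquiv_apply]
  have hv0 : ∀ m, κ' m = 0 → IsOfHodgeType (Y.prod E).dim (Y.prod E).X 1 1 0 (v m) := by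
    intro m hm
    rw [hv_apply, ← BettiUniverse.mem_hodge_piece_iff hHD hI hXP (k := 1) (p := 1) (q := 0) rfl]
    have hsplit : φ m = ((φ m).1, 0) := by
      change (φ m).2 = 0 at hm; rw [← hm]
    rw [hsplit]
    exact hcbx0 _
  have hv1 : ∀ m, κ' m = 1 → IsOfHodgeType (Y.prod E).dim (Y.prod E).X 1 0 1 (v m) := by
    intro m hm
    rw [hv_apply, ← BettiUniverse.mem_hodge_piece_iff hHD hI hXP (k := 1) (p := 0) (q := 1) rfl]
    have hsplit : φ m = ((φ m).1, 1) := by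
      change (φ m).2 = 1 at hm; rw [← hm]
    rw [hsplit]
    exact hcbx1 _
  -- (α) an antisymmetric kind-balanced coefficient function in the adapted letters
  obtain ⟨ax, hax_bal, hax_anti, hcax⟩ := hg.exists_antisymm_kindBalanced_wordEval_eq v κ' hv0 hv1 hp hc
  -- the change of letters to the rational letters
  set G : Matrix _ _ ℂ := eC.toMatrix cbσ with hG
  set G' : Matrix _ _ ℂ := cbσ.toMatrix eC with hG'
  have hG'G : G' * G = 1 := cbσ.toMatrix_mul_toMatrix_flip eC
  have hve : ∀ m, v m = ∑ i, G i m • eL i := fun m => by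
    simp only [hv, heL, Module.Basis.map_apply, ← map_smul, ← map_sum]
    congr 1
    exact (eC.sum_toMatrix_smul_self (v := ⇑cbσ) (j := m)).symm
  have hletters : ∀ j m, avLetters g v (j, m) = ∑ i, G i m • avLetters g eL (j, i) :=
    avLetters_baseChange g G hve
  set aE := colourChangeAt (fun _ : Fin 1 => G) ax with haE
  have haE_anti : IsAntisymm aE := hax_anti.colourChangeAt _
  have hcaE : wordEval (cupPowOneAlt ℂ (Motives.ComplexPoints X.X) (2 * p)) (avLetters g eL) aE = c := by
    rw [haE, ← wordEval_eq_wordEval_colourChangeAt _ (fun _ : Fin 1 => G) hletters ax, hcax]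
  -- rationality of `aE`
  have hFinj : Function.Injective (exteriorPower.alternatingMapLinearEquiv
      (cupPowOneAlt ℂ (Motives.ComplexPoints X.X) (2 * p))) :=
    injective_alternatingMapLinearEquiv_cupPowOneAlt X (2 * p)
  obtain ⟨q, hq⟩ := hg.exists_rat_wordEval_eq eL heLQ hcQ
  obtain ⟨q', -, haEq⟩ := haE_anti.exists_eq_algebraMap_of_wordEval_eq hFinj (hg.letterBasis eL)
    (q := q) (by rw [AVSlots.coe_letterBasis, hcaE, hq])
  have hslice_e : ∀ u, wordSlice aE u = wordRepAt ℂ (fun _ : Fin (2 * p) => G) (wordSlice ax u) :=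
    fun u => wordSlice_colourChangeAt (fun _ : Fin 1 => G) ax u
  -- the Hodge operator `Θ` of `H¹(Y × E)`: `diag(±1)` in the adapted letters
  obtain ⟨Θ, hΘ⟩ := exists_hodgeTheta (BettiUniverse.hodge hHD hXP 1)
  have hΘb : ∀ m, Θ (cbσ m) = (if κ' m = 0 then (1 : ℂ) else -1) • cbσ m := by
    intro m
    rw [hcbσ]
    change Θ _ = (if (φ m).2 = 0 then (1 : ℂ) else -1) • _
    rcases fin2_eq_zero_or_one_w (φ m).2 with h0 | h1
    · rw [h0, if_pos rfl]
      have hmem : cbx (φ m) ∈ (BettiUniverse.hodge hHD hXP 1).piece 1 (((1 : ℕ) : ℤ) - 1) := by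
        have e : (((1 : ℕ) : ℤ) - 1) = 0 := by norm_num
        have hsplit : φ m = ((φ m).1, 0) := by rw [← h0]
        rw [e, hsplit]; exact hcbx0 _
      rw [hΘ 1 _ hmem]
      norm_num
    · rw [h1, if_neg one_ne_zero]
      have hmem : cbx (φ m) ∈ (BettiUniverse.hodge hHD hXP 1).piece 0 (((1 : ℕ) : ℤ) - 0) := by
        have e : (((1 : ℕ) : ℤ) - 0) = 1 := by norm_num
        have hsplit : φ m = ((φ m).1, 1) := by rw [← h1]
        rw [e, hsplit]; exact hcbx1 _
      rw [hΘ 0 _ hmem]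
      norm_num
  have hΘcb : LinearMap.toMatrix cbσ cbσ Θ = kindDiag κ' := by
    ext i m
    rw [LinearMap.toMatrix_apply, hΘb, map_smul, Module.Basis.repr_self, Finsupp.smul_apply,
      Finsupp.single_apply, kindDiag, Matrix.diagonal_apply, smul_eq_mul, mul_ite, mul_one, mul_zero]
    by_cases him : i = m
    · subst him; rw [if_pos rfl]
    · rw [if_neg (Ne.symm him), if_neg him]
  have hJG : LinearMap.toMatrix eC eC Θ * G = G * kindDiag κ' := by
    rw [← hΘcb, hG, linearMap_toMatrix_mul_basis_toMatrix, basis_toMatrix_mul_linearMap_toMatrix]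
  have hΘq : ∀ u : Fin (2 * p) → Fin 1, wordDerAt ℂ (fun _ : Fin (2 * p) => LinearMap.toMatrix eC eC Θ)
      (wordSlice (fun w => algebraMap ℚ ℂ (q' w)) u) = 0 := by
    intro u
    rw [← haEq, hslice_e]
    refine wordDerAt_wordRepAt_eq_zero_of_mul_eq ℂ (fun _ : Fin (2 * p) => G) (fun _ => hJG) ?_
    rw [wordDerAt_const]
    exact wordDer_kindDiag_wordSlice_eq_zero κ' hax_bal u
  -- the Hodge operators `Θ_Y`, `Θ_E`, and the data of the CM curve
  obtain ⟨ΘA, hΘA⟩ := exists_hodgeTheta (BettiUniverse.hodge hHD hXA 1)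
  obtain ⟨ΘC, hΘC⟩ := exists_hodgeTheta (BettiUniverse.hodge hHD hXC 1)
  have hχE := pullback_mem_endAlg hHD hI χ
  have hχ2 : (bettiCohomology.map χ.hom.hom.hom 1).hom * (bettiCohomology.map χ.hom.hom.hom 1).hom =
      -((d : ℚ) • 1) := bettiMapHom_mul_self hχ
  have hV₂ : Module.finrank ℚ (bettiCohomology E.X 1) = 2 := by rw [finrank_bettiCohomology_one E, hE1]
  -- structure of the adapted dual basis for `ψ_ℂ` and `φ_ℂ`
  set Ψ := ψ.form.baseChange ℂ with hΨ
  have hφskewC : ∀ x y, Ψ (φQ.baseChange ℂ x) y + Ψ x (φQ.baseChange ℂ y) = 0 := by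
    haveI : Nontrivial (bettiCohomology Y.X 1) := by
      refine Module.nontrivial_of_finrank_pos (R := ℚ) ?_
      rw [finrank_bettiCohomology_one Y]; omega
    exact ThetaSubalgebra.formBaseChange_add_eq_zero_of_skew ψ
      (UnitaryTheta.form_apply_add_form_apply_eq_zero _ ψ hφE hdQ hφ2 hE)
  have hiso0 : ∀ i j, Ψ (cb (0, i)) (cb (0, j)) = 0 := fun i j =>
    UnitaryTheta.form_eq_zero_of_mem_eigenspace hφskewC hμ0 (hcbW i) (hcbW j)
  have hiso1 : ∀ i j, Ψ (cb (1, i)) (cb (1, j)) = 0 := fun i j =>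
    UnitaryTheta.form_eq_zero_of_mem_eigenspace hφskewC (neg_ne_zero.2 hμ0) (hcbW' i) (hcbW' j)
  have hswap10 : ∀ i j, Ψ (cb (1, i)) (cb (0, j)) = -(if j = i then 1 else 0) := fun i j => by
    rw [hΨ, ψ.form_baseChange_swap, show (((1 : ℕ) : ℤ)).negOnePow = -1 from Int.negOnePow_one, ← hΨ, hdual]
    split_ifs <;> simp
  have hφcb0 : ∀ ℓ, φQ.baseChange ℂ (cb (0, ℓ)) = μ • cb (0, ℓ) := fun ℓ =>
    Module.End.mem_eigenspace_iff.1 (hcbW ℓ)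
  have hφcb1 : ∀ ℓ, φQ.baseChange ℂ (cb (1, ℓ)) = (-μ) • cb (1, ℓ) := fun ℓ =>
    Module.End.mem_eigenspace_iff.1 (hcbW' ℓ)
  -- the elementary operators `P_{ij} ∈ 𝔲_{k'}(H¹Y, ψ)_ℂ ≅ 𝔤𝔩(W)`: `e_j ↦ e_i`, `f_i ↦ -f_j`
  have hops : ∀ i j : Fin n₀, ∃ P : Module.End ℂ (ℂ ⊗[ℚ] bettiCohomology Y.X 1),
      (∀ ℓ, P (cb (0, ℓ)) = if ℓ = j then cb (0, i) else 0) ∧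
      (∀ ℓ, P (cb (1, ℓ)) = if ℓ = i then -cb (1, j) else 0) ∧
      P * φQ.baseChange ℂ = φQ.baseChange ℂ * P ∧ (∀ x y, Ψ (P x) y + Ψ x (P y) = 0) := by
    intro i j
    set P : Module.End ℂ (ℂ ⊗[ℚ] bettiCohomology Y.X 1) := cb.constr ℂ (fun tl : Fin 2 × Fin n₀ =>
      if tl.1 = 0 then (if tl.2 = j then cb (0, i) else 0) else (if tl.2 = i then -cb (1, j) else 0)) with hPdef
    have hP0 : ∀ ℓ, P (cb (0, ℓ)) = if ℓ = j then cb (0, i) else 0 := fun ℓ => by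
      rw [hPdef, Module.Basis.constr_basis]; simp
    have hP1 : ∀ ℓ, P (cb (1, ℓ)) = if ℓ = i then -cb (1, j) else 0 := fun ℓ => by
      rw [hPdef, Module.Basis.constr_basis]; simp
    refine ⟨P, hP0, hP1, ?_, ?_⟩
    · refine cb.ext fun tl => ?_
      obtain ⟨t, ℓ⟩ := tl
      rcases fin2_eq_zero_or_one_w t with rfl | rfl
      · rw [Module.End.mul_apply, Module.End.mul_apply, hφcb0, map_smul, hP0]
        by_cases hℓ : ℓ = j
        · rw [if_pos hℓ, hφcb0]
        · rw [if_neg hℓ, map_zero, smul_zero]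
      · rw [Module.End.mul_apply, Module.End.mul_apply, hφcb1, map_smul, hP1]
        by_cases hℓ : ℓ = i
        · rw [if_pos hℓ, map_neg, hφcb1, smul_neg]
        · rw [if_neg hℓ, map_zero, smul_zero]
    · have hB : Ψ ∘ₗ P + Ψ.compl₂ P = 0 := by
        refine LinearMap.BilinForm.ext_basis cb fun tk tl => ?_
        obtain ⟨t, k⟩ := tk
        obtain ⟨t', ℓ⟩ := tl
        rw [LinearMap.add_apply, LinearMap.add_apply, LinearMap.comp_apply, LinearMap.compl₂_apply,
          LinearMap.zero_apply, LinearMap.zero_apply]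
        rcases fin2_eq_zero_or_one_w t with rfl | rfl <;> rcases fin2_eq_zero_or_one_w t' with rfl | rfl
        · rw [hP0, hP0]
          split_ifs <;> simp [hiso0]
        · rw [hP0, hP1]
          by_cases hk : k = j <;> by_cases hl : ℓ = i
          · subst hk; subst hl; simp [hdual]
          · subst hk; rw [if_pos rfl, if_neg hl, map_zero, add_zero, hdual, if_neg (Ne.symm hl)]
          · subst hl; rw [if_neg hk, if_pos rfl, map_zero, LinearMap.zero_apply, zero_add, map_neg, hdual,
              if_neg hk, neg_zero]
          · rw [if_neg hk, if_neg hl, map_zero, LinearMap.zero_apply, map_zero, add_zero]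
        · rw [hP1, hP0]
          by_cases hk : k = i <;> by_cases hl : ℓ = j
          · subst hk; subst hl; simp [hswap10]
          · subst hk; rw [if_pos rfl, if_neg hl, map_zero, add_zero, map_neg, LinearMap.neg_apply, hswap10,
              if_neg hl, neg_zero, neg_zero]
          · subst hl; rw [if_neg hk, if_pos rfl, map_zero, LinearMap.zero_apply, zero_add, hswap10,
              if_neg (Ne.symm hk), neg_zero]
          · rw [if_neg hk, if_neg hl, map_zero, LinearMap.zero_apply, map_zero, add_zero]
        · rw [hP1, hP1]
          split_ifs <;> simp [hiso1]
      intro x y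
      have h := LinearMap.congr_fun (LinearMap.congr_fun hB x) y
      simpa only [LinearMap.add_apply, LinearMap.comp_apply, LinearMap.compl₂_apply, LinearMap.zero_apply]
        using h
  -- the root differences `D_{ij} = [P_{ij}, P_{ji}] = E_ii - E_jj` (on `W`; `-(E_ii - E_jj)` on `W'`) kill the tensor
  have hYG : ∀ Z : Module.End ℂ (ℂ ⊗[ℚ] bettiCohomology (Y.prod E).X 1), ∀ _t : Fin (2 * p),
      LinearMap.toMatrix eC eC Z * G = G * LinearMap.toMatrix cbσ cbσ Z :=
    fun Z _ => by rw [hG, linearMap_toMatrix_mul_basis_toMatrix, basis_toMatrix_mul_linearMap_toMatrix]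
  -- the diagonal weights of `ι_Y D_{ij} π_Y`: `±([ℓ = i] - [ℓ = j])` at the `Y`-places (sign `+` iff in `W`), `0` at `E`
  set δ : Fin n₀ → Fin n₀ → (Fin n₀ ⊕ Fin h) → Fin 2 → ℤ := fun i j T r =>
    Sum.elim (fun ℓ => (if r = κ ℓ then (1 : ℤ) else -1) * ((if ℓ = i then (1 : ℤ) else 0) - (if ℓ = j then 1 else 0)))
      (fun _ => (0 : ℤ)) T with hδ
  have hax : ∀ i j : Fin n₀, ∀ u : Fin (2 * p) → Fin 1,
      wordDerAt ℂ (fun _ : Fin (2 * p) => blockLift φ (fun T => Matrix.diagonal fun r => ((δ i j T r : ℤ) : ℂ)))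
        (wordSlice ax u) = 0 := by
    intro i j u
    obtain ⟨P, hP0, hP1, hPφ, hPskew⟩ := hops i j
    obtain ⟨P', hP'0, hP'1, hP'φ, hP'skew⟩ := hops j i
    -- `D` is diagonal on `cb`
    have hD0 : ∀ ℓ, (P * P' - P' * P) (cb (0, ℓ)) = (if ℓ = i then cb (0, ℓ) else 0) - (if ℓ = j then cb (0, ℓ) else 0) := by
      intro ℓ
      have hPj : P (cb (0, j)) = cb (0, i) := by rw [hP0, if_pos rfl]
      have hP'i : P' (cb (0, i)) = cb (0, j) := by rw [hP'0, if_pos rfl]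
      rw [LinearMap.sub_apply, Module.End.mul_apply, Module.End.mul_apply, hP'0, hP0]
      by_cases hi : ℓ = i <;> by_cases hj : ℓ = j
      · simp only [if_pos hi, if_pos hj, hPj, hP'i]
        rw [← hi, ← hj]
      · simp only [if_pos hi, if_neg hj, hPj, map_zero]
        rw [hi]
      · simp only [if_neg hi, if_pos hj, hP'i, map_zero]
        rw [hj]
      · simp only [if_neg hi, if_neg hj, map_zero, sub_self]
    have hD1 : ∀ ℓ, (P * P' - P' * P) (cb (1, ℓ)) = (if ℓ = j then cb (1, ℓ) else 0) - (if ℓ = i then cb (1, ℓ) else 0) := by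
      intro ℓ
      have hPi : P (cb (1, i)) = -cb (1, j) := by rw [hP1, if_pos rfl]
      have hP'j : P' (cb (1, j)) = -cb (1, i) := by rw [hP'1, if_pos rfl]
      have hPi' : P (-cb (1, i)) = cb (1, j) := by rw [map_neg P (cb (1, i)), hPi, neg_neg]
      have hP'j' : P' (-cb (1, j)) = cb (1, i) := by rw [map_neg P' (cb (1, j)), hP'j, neg_neg]
      rw [LinearMap.sub_apply, Module.End.mul_apply, Module.End.mul_apply, hP'1, hP1]
      by_cases hi : ℓ = i <;> by_cases hj : ℓ = j
      · simp only [if_pos hi, if_pos hj, hPi', hP'j']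
        rw [← hi, ← hj]
      · simp only [if_pos hi, if_neg hj, map_zero, hP'j']
        rw [hi]
      · simp only [if_neg hi, if_pos hj, hPi', map_zero]
        rw [hj]
      · simp only [if_neg hi, if_neg hj, map_zero, sub_self]
    have hDbY : ∀ ℓ r, (P * P' - P' * P) (bY (ℓ, r)) = ((δ i j (Sum.inl ℓ) r : ℤ) : ℂ) • bY (ℓ, r) := by
      intro ℓ r
      rw [hbY]
      by_cases hr : r = κ ℓ
      · rw [if_pos hr, hD0, ite_sub_ite_eq_cast_smul_w]
        congr 2
        simp only [hδ, Sum.elim_inl, if_pos hr]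
        ring
      · rw [if_neg hr, hD1, ite_sub_ite_eq_cast_smul_w]
        congr 2
        simp only [hδ, Sum.elim_inl, if_neg hr]
        ring
    -- the Lie step: `ι_Y D π_Y` kills the rational coefficient tensor
    have hL : wordDerAt ℂ (fun _ : Fin (2 * p) => LinearMap.toMatrix eC eC
          (ι₁.baseChange ℂ ∘ₗ (P * P' - P' * P) ∘ₗ π₁.baseChange ℂ))
        (wordSlice (fun w => algebraMap ℚ ℂ (q' w)) u) = 0 :=
      wordDerAt_incl_bracket_proj_eq_zero_of_unitary_times_cmCurve hn1 (BettiUniverse.hodge hHD hXP 1)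
        (BettiUniverse.hodge hHD hXA 1) (BettiUniverse.hodge hHD hXC 1) heffA
        (BettiUniverse.hodge_isEffective hHD hXC 1) hπι₁ hπι₂ hπ₁ι₂ hπ₂ι₁ hsum hι₁F hι₂F ψ ψC hφE hdQ hφ2 hE hμ
        h1' h2' hχE hdQ hχ2 hV₂ eQ q' hΘ hΘA hΘC hΘq hPφ hPskew hP'φ hP'skew u
    -- the matrix of `Z` in the pair letters is the diagonal block family
    have hblk : LinearMap.toMatrix cbσ cbσ (ι₁.baseChange ℂ ∘ₗ (P * P' - P' * P) ∘ₗ π₁.baseChange ℂ) =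
        blockLift φ (fun T => Matrix.diagonal fun r => ((δ i j T r : ℤ) : ℂ)) := by
      refine toMatrix_eq_blockLift_of_apply_basis φ cbσ _ _ fun m => ?_
      rw [hcbσ m]
      have hb' : ∀ a, cbσ (φ.symm ((φ m).1, a)) = cbx ((φ m).1, a) := fun a => by
        rw [hcbσ, Equiv.apply_symm_apply]
      simp only [hb']
      obtain ⟨T, r⟩ := φ m
      rw [Finset.sum_eq_single r]
      · rw [Matrix.diagonal_apply_eq]
        rcases T with ℓ | e
        · simp only [hcbx, Sum.elim_inl]
          rw [LinearMap.comp_apply, LinearMap.comp_apply, e11, hDbY, map_smul]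
        · simp only [hcbx, Sum.elim_inr]
          rw [LinearMap.comp_apply, LinearMap.comp_apply, e12, map_zero, map_zero]
          have h0 : ((δ i j (Sum.inr e) r : ℤ) : ℂ) = 0 := by simp only [hδ, Sum.elim_inr, Int.cast_zero]
          rw [h0, zero_smul]
      · intro a _ ha
        simp only [Matrix.diagonal_apply_ne _ ha, zero_smul]
      · intro hr; exact absurd (Finset.mem_univ r) hr
    have hLu := hL
    rw [← haEq, hslice_e] at hLu
    have h3 : wordRepAt ℂ (fun _ : Fin (2 * p) => G)
        (wordDerAt ℂ (fun _ : Fin (2 * p) => blockLift φ (fun T => Matrix.diagonal fun r => ((δ i j T r : ℤ) : ℂ)))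
          (wordSlice ax u)) = 0 := by
      rw [← hblk, wordRepAt_wordDerAt_of_mul_eq ℂ (fun _ : Fin (2 * p) => G) (hYG _), hLu]
    exact wordRepAt_injective ℂ (g := fun _ : Fin (2 * p) => G) (g' := fun _ : Fin (2 * p) => G')
      (funext fun _ => hG'G) (by rw [h3, map_zero])
  -- the coefficient function, refined to slot-and-place colours
  refine ⟨placeRefine φ ax, ?_, fun U η hU => ?_⟩
  · rw [← hcax]
    have hx : (fun jr : (Fin 1 × (Fin n₀ ⊕ Fin h)) × Fin 2 => avLetters g v (jr.1.1, φ.symm (jr.1.2, jr.2))) =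
        fun jr : (Fin 1 × (Fin n₀ ⊕ Fin h)) × Fin 2 => complexBetti.map (g jr.1.1).hom.hom.hom 1
          (Sum.elim
            (fun i => complexBetti.map (Motives.AbelianVariety.fst Y E).hom.hom.hom 1
              (ofRatClassBaseChange (Motives.ComplexPoints Y.X) 1 (bY (i, jr.2))))
            (fun i => complexBetti.map (Motives.AbelianVariety.snd Y E).hom.hom.hom 1
              (ofRatClassBaseChange (Motives.ComplexPoints E.X) 1 (cC (i, jr.2))))
            jr.1.2) := by
      funext jr
      rw [avLetters_apply, hv_apply, Equiv.apply_symm_apply, hcbx]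
      obtain ⟨⟨j, t⟩, r⟩ := jr
      rcases t with i | i
      · simp only [Sum.elim_inl]
        congr 1
        rw [hι₁, ← ofRatClassBaseChangeEquiv_apply (hX := hXP), ← ofRatClassBaseChangeEquiv_apply (hX := hXA),
          complexBetti_map_ofRatClassBaseChangeEquiv hXP hXA]
      · simp only [Sum.elim_inr]
        congr 1
        rw [hι₂, ← ofRatClassBaseChangeEquiv_apply (hX := hXP), ← ofRatClassBaseChangeEquiv_apply (hX := hXC),
          complexBetti_map_ofRatClassBaseChangeEquiv hXP hXC]
    rw [← hx]
    exact wordEval_placeRefine _ φ (avLetters g v) ax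
  · -- words with a repeated letter: antisymmetry
    have hanti' : IsAntisymm (placeRefine φ ax) := fun σ w =>
      hax_anti σ (fun t => ((w t).1.1, φ.symm ((w t).1.2, (w t).2)))
    have hinjw : Function.Injective (fun t => (U t, η t)) := by
      by_contra hni
      exact hU (hanti'.apply_eq_zero_of_not_injective hni)
    -- injectivity of the place-and-kind word (ONE slot)
    have hinjP : Function.Injective fun t => ((U t).2, η t) := by
      intro t t' htt
      simp only [Prod.mk.injEq] at htt
      refine hinjw ?_
      simp only [Prod.mk.injEq]
      exact ⟨Prod.ext (Subsingleton.elim _ _) htt.1, htt.2⟩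
    refine ⟨hinjP, ?_⟩
    -- `Θ`-balance
    have hval : placeRefine φ ax (fun t => (U t, η t)) = ax (fun t => ((U t).1, φ.symm ((U t).2, η t))) := rfl
    have hbal := hax_bal _ (by rw [← hval]; exact hU)
    have hcnt : ∀ r : Fin 2, (Finset.univ.filter fun t => η t = r).card = p := by
      intro r
      have hb := hbal r
      simp only [wordContent, hκ', Equiv.apply_symm_apply] at hb
      exact hb
    have hΘw : ∑ t, (if η t = 0 then (1 : ℤ) else -1) = 0 := by
      rw [sum_kindSign_eq_card_sub_card' Finset.univ η, hcnt 0, hcnt 1, sub_self]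
    -- root-difference weights
    have hDw : ∀ i j : Fin n₀, ∑ t, Sum.elim (fun ℓ => (if η t = κ ℓ then (1 : ℤ) else -1) *
        ((if ℓ = i then (1 : ℤ) else 0) - (if ℓ = j then (1 : ℤ) else 0))) (fun _ => (0 : ℤ)) (U t).2 = 0 := by
      intro i j
      have h2 : wordDerAt ℂ (fun t => Matrix.diagonal fun r => ((δ i j (U t).2 r : ℤ) : ℂ))
          (wordSlice (placeRefine φ ax) U) = 0 :=
        wordDerAt_placeFamily_placeRefine_eq_zero φ (fun T => Matrix.diagonal fun r => ((δ i j T r : ℤ) : ℂ)) (hax i j) U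
      by_contra hw
      refine hU (eq_zero_of_wordDerAt_diagonal_eq_zero (fun t r => ((δ i j (U t).2 r : ℤ) : ℂ)) h2 η ?_)
      rw [← Int.cast_sum, Int.cast_ne_zero]
      simpa only [hδ] using hw
    -- the trichotomy
    exact kindWeight_eq_zero_or_weilWord_of_rootDiffWeights κ (fun t => (U t).2) η hinjP (by omega) hκ hΘw hDw

end Invariance

/-! ### §3 Weil words are Weil classes; `(T × E, φ × χ)` is of Weil type -/

section WeilWords

variable {Y E : AbelianVariety ℂ}

/-- `hodgeOneZero` along an equality of the dimension index. [folklore] -/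
private theorem hodgeOneZero_eq_of_eq' {X : Motives.SchemeOver ℂ} {N N' : ℕ} (hX : IsSmoothProjective N X)
    (hX' : IsSmoothProjective N' X) (h : N = N') : hodgeOneZero hX = hodgeOneZero hX' := by
  subst h
  rfl

/-- Joint eigenclasses of the test pull-backs with character `(x + yν)^{2n}`, `ν = ± i√d`, are Weil classes
(`E₊` for `ν = i√d`, `E₋` for `ν = -i√d`). [cite: vanGeemen1994HodgeAV, 4.9] -/
private theorem mem_weilClassesOf_of_mem_pullbackEigenclasses_pow {A : AbelianVariety ℂ} (ψ : A ⟶ A) {n d : ℕ}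
    {ν : ℂ} (hν : ν = Complex.I * (Real.sqrt d : ℂ) ∨ ν = -(Complex.I * (Real.sqrt d : ℂ)))
    {c : complexBetti A.X (2 * n)}
    (hc : c ∈ pullbackEigenclasses A ψ (2 * n) (fun x y => ((x : ℂ) + (y : ℂ) * ν) ^ (2 * n))) :
    c ∈ weilClassesOf A ψ n d := by
  rcases hν with rfl | rfl
  · refine weilClassesPlus_le_weilClassesOf A ψ n d ?_
    rw [mem_weilClassesPlus_iff]
    intro x y
    rw [(mem_pullbackEigenclasses_iff.1 hc) x y, mul_assoc]
  · refine weilClassesMinus_le_weilClassesOf A ψ n d ?_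
    rw [mem_weilClassesMinus_iff]
    intro x y
    rw [(mem_pullbackEigenclasses_iff.1 hc) x y, mul_neg, ← sub_eq_add_neg, mul_assoc]

/-- `pr_T^*` of a `c`-eigenvector of `φ^*` is a `c`-eigenvector of `(φ × χ)^*` (`(φ × χ) ≫ pr_T = pr_T ≫ φ`). [folklore] -/
private theorem map_fst_mem_eigenspace_prodLift (φY : Y ⟶ Y) (χ : E ⟶ E) {c : ℂ} {v : complexBetti Y.X 1}
    (hv : v ∈ Module.End.eigenspace (complexBetti.map φY.hom.hom.hom 1).hom c) :
    complexBetti.map (Motives.AbelianVariety.fst Y E).hom.hom.hom 1 v ∈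
      Module.End.eigenspace (complexBetti.map (Motives.AbelianVariety.prodLift
        (Motives.AbelianVariety.fst Y E ≫ φY) (Motives.AbelianVariety.snd Y E ≫ χ)).hom.hom.hom 1).hom c := by
  rw [Module.End.mem_eigenspace_iff] at hv ⊢
  change complexBetti.map _ 1 (complexBetti.map _ 1 v) = _
  rw [complexBetti_map_map_hom, Motives.AbelianVariety.prodLift_fst, ← complexBetti_map_map_hom]
  change complexBetti.map _ 1 ((complexBetti.map φY.hom.hom.hom 1).hom v) = _
  rw [hv, map_smul]

/-- `pr_E^*` of a `c`-eigenvector of `χ^*` is a `c`-eigenvector of `(φ × χ)^*`. [folklore] -/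
private theorem map_snd_mem_eigenspace_prodLift (φY : Y ⟶ Y) (χ : E ⟶ E) {c : ℂ} {v : complexBetti E.X 1}
    (hv : v ∈ Module.End.eigenspace (complexBetti.map χ.hom.hom.hom 1).hom c) :
    complexBetti.map (Motives.AbelianVariety.snd Y E).hom.hom.hom 1 v ∈
      Module.End.eigenspace (complexBetti.map (Motives.AbelianVariety.prodLift
        (Motives.AbelianVariety.fst Y E ≫ φY) (Motives.AbelianVariety.snd Y E ≫ χ)).hom.hom.hom 1).hom c := by
  rw [Module.End.mem_eigenspace_iff] at hv ⊢
  change complexBetti.map _ 1 (complexBetti.map _ 1 v) = _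
  rw [complexBetti_map_map_hom, Motives.AbelianVariety.prodLift_snd, ← complexBetti_map_map_hom]
  change complexBetti.map _ 1 ((complexBetti.map χ.hom.hom.hom 1).hom v) = _
  rw [hv, map_smul]

/-- **`(T × E, φ × χ)` is of WEIL TYPE `(2, d)`** when `T` is a threefold with `φ ≫ φ = -d` of multiplicity `1` at `μ₀`
and `E` an elliptic curve with `χ ≫ χ = -d` of multiplicity `1` at the same `μ₀ ∈ {± i√d}` (multiplicities add over the
product: `(1,2) + (1,0) = (2,2)`; Moonen–Zarhin (1.9), case (a): «there exists an embedding `k ↪ End⁰(X₂)`», the Weil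
classes `W_k ⊂ B²(X)` of Thm. 0.1 (1) being those of this `k`-action).
[cite: MoonenZarhin1999LowDim, (1.9) and Thm. 0.1 (1) with case (a)] [cite: vanGeemen1994HodgeAV, 4.9] -/
theorem isWeilType_prod_cmCurve_of_unitaryTwoOne (hY3 : Y.dim = 3) (φY : Y ⟶ Y) {d : ℕ} (hd : 0 < d)
    (hφY : φY ≫ φY = -(d • 𝟙 Y)) {μ₀ : ℂ}
    (hμ₀ : μ₀ = Complex.I * (Real.sqrt d : ℂ) ∨ μ₀ = -(Complex.I * (Real.sqrt d : ℂ)))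
    (hmY : eigenMultiplicity Y φY μ₀ = 1) (hE1 : E.dim = 1) (χ : E ⟶ E) (hχ : χ ≫ χ = -(d • 𝟙 E))
    (hmE : eigenMultiplicity E χ μ₀ = 1) :
    IsWeilType (Y.prod E) (Motives.AbelianVariety.prodLift (Motives.AbelianVariety.fst Y E ≫ φY)
      (Motives.AbelianVariety.snd Y E ≫ χ)) 2 d := by
  have hdim : (Y.prod E).dim = 2 * 2 := by rw [Motives.AbelianVariety.dim_prod, hY3, hE1]
  refine ⟨two_pos, hd, hdim, prodLift_comp_self_eq_neg hφY hχ, ?_⟩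
  have h := finrank_eigenspace_inf_hodgeOneZero_prod (rfl : Y.dim = Y.dim) (rfl : E.dim = E.dim) φY χ
    (Complex.I * (Real.sqrt d : ℂ))
  have hsumY := eigenMultiplicity_add_eigenMultiplicity_neg_eq_dim Y φY hd hφY
  have hsumE := eigenMultiplicity_add_eigenMultiplicity_neg_eq_dim E χ hd hχ
  have hval : eigenMultiplicity Y φY (Complex.I * (Real.sqrt d : ℂ)) +
      eigenMultiplicity E χ (Complex.I * (Real.sqrt d : ℂ)) = 2 := by
    rcases hμ₀ with h0 | h0
    · rw [h0] at hmY hmE; omega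
    · rw [h0] at hmY hmE; omega
  change Module.finrank ℂ _ = eigenMultiplicity Y φY (Complex.I * (Real.sqrt d : ℂ)) +
    eigenMultiplicity E χ (Complex.I * (Real.sqrt d : ℂ)) at h
  rw [hval, hodgeOneZero_eq_of_eq' _ (Motives.isSmoothProjective_of_dim_eq' hdim)
    (by rw [hY3, hE1] : Y.dim + E.dim = 2 * 2)] at h
  exact h

end WeilWords

/-! ### §4 Word combinatorics of the Künneth degree: Weil words have `E`-degree `1`, balanced words an even `T`-degree -/

section KunnethDegree

variable {hA h dd : ℕ}

/-- The two cardinalities of a left/right split add up to the number of positions. [folklore] -/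
private theorem card_isLeft_add_card_not_isLeft_w {T P : Type*} (col : Fin dd → T ⊕ P) :
    Fintype.card {t // (col t).isLeft = true} + Fintype.card {t // ¬ (col t).isLeft = true} = dd := by
  classical
  rw [Fintype.card_subtype_compl, Nat.add_sub_cancel' (Fintype.card_subtype_le _), Fintype.card_fin]

/-- `¬ isLeft` iff the letter is an `inr`. [folklore] -/
private theorem not_isLeft_iff_exists_inr {α β : Type*} (s : α ⊕ β) : ¬ s.isLeft = true ↔ ∃ e, s = Sum.inr e := by
  rcases s with a | e
  · simp
  · simp

/-- A word whose place map is injective, with `h ≤ 1` places on the `E`-side and at least one `E`-letter, has exactly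
ONE `E`-position. [folklore] -/
private theorem card_not_isLeft_eq_one (P : Fin dd → Fin hA ⊕ Fin h) (hinjP : Function.Injective P) (hh : h ≤ 1)
    (hex : ∃ t e, P t = Sum.inr e) : Fintype.card {t // ¬ (P t).isLeft = true} = 1 := by
  classical
  rw [Fintype.card_subtype]
  have hle : (Finset.univ.filter fun t => ¬ (P t).isLeft = true).card ≤
      ((Finset.univ : Finset (Fin h)).map ⟨(Sum.inr : Fin h → Fin hA ⊕ Fin h), Sum.inr_injective⟩).card := by
    refine Finset.card_le_card_of_injOn P (fun t ht => ?_) (fun t _ t' _ hPP => hinjP hPP)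
    obtain ⟨e, he⟩ := (not_isLeft_iff_exists_inr _).1 (Finset.mem_filter.1 ht).2
    simp [he]
  rw [Finset.card_map, Finset.card_univ, Fintype.card_fin] at hle
  obtain ⟨t, e, hte⟩ := hex
  have hpos : 0 < (Finset.univ.filter fun t => ¬ (P t).isLeft = true).card :=
    Finset.card_pos.2 ⟨t, Finset.mem_filter.2 ⟨Finset.mem_univ _, by simp [hte]⟩⟩
  omega

/-- A `T`-kind-balanced word has an EVEN number of `T`-positions. [folklore] -/
private theorem even_card_isLeft_of_balanced (P : Fin dd → Fin hA ⊕ Fin h) (η : Fin dd → Fin 2)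
    (hbal : ∑ t, Sum.elim (fun _ : Fin hA => if η t = 0 then (1 : ℤ) else -1) (fun _ : Fin h => (0 : ℤ)) (P t) = 0) :
    Even (Fintype.card {t // (P t).isLeft = true}) := by
  classical
  set A0 := (Finset.univ.filter fun t => (P t).isLeft = true ∧ η t = 0).card with hA0
  set A1 := (Finset.univ.filter fun t => (P t).isLeft = true ∧ η t = 1).card with hA1
  have hsum : ∑ t, Sum.elim (fun _ : Fin hA => if η t = 0 then (1 : ℤ) else -1) (fun _ : Fin h => (0 : ℤ)) (P t) =
      (A0 : ℤ) - (A1 : ℤ) := by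
    rw [hA0, hA1, Finset.card_filter, Finset.card_filter, Nat.cast_sum, Nat.cast_sum, ← Finset.sum_sub_distrib]
    refine Finset.sum_congr rfl fun t _ => ?_
    rcases hP : P t with ℓ | e
    · rcases Fin.exists_fin_two.1 ⟨η t, rfl⟩ with h0 | h0 <;> simp [h0]
    · simp
  have hcard : Fintype.card {t // (P t).isLeft = true} = A0 + A1 := by
    rw [Fintype.card_subtype, hA0, hA1,
      ← Finset.card_filter_add_card_filter_not (s := Finset.univ.filter fun t => (P t).isLeft = true)
        (fun t => η t = 0), Finset.filter_filter, Finset.filter_filter]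
    congr 2
    refine Finset.filter_congr fun t _ => ?_
    rcases Fin.exists_fin_two.1 ⟨η t, rfl⟩ with h0 | h0 <;> simp [h0]
  rw [hsum] at hbal
  have hA01 : A0 = A1 := by omega
  exact ⟨A0, by rw [hcard, hA01]⟩

end KunnethDegree

/-! ### §5 `B²(T × E) ⊆ D²(T × E) + W_k`: Moonen–Zarhin Thm. 0.1 (1) for case (a1) -/

section DivisorWeil

open MonoidalCategory CartesianMonoidalCategory

variable {Y E : AbelianVariety ℂ}

set_option maxHeartbeats 1600000 in
open scoped Classical in
/-- **MOONEN–ZARHIN 1999 Thm. 0.1 (1), case (a1) — a THEOREM: `B•(T × E)` is generated by divisor classes and the Weil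
classes `W_k ⊂ B²(T × E)`.** Let `T` (here `Y`) be a complex abelian threefold with `dim_ℚ End⁰(T) = 2`, `φ ≫ φ = -d`
(`d > 0`), multiplicity `1` at `μ₀ ∈ {± i√d}` (so `End⁰(T) = k = ℚ(√-d)` acts with multiplicities `(2,1)`: type
IV(1,1)), and `E` an elliptic curve with `χ ≫ χ = -d` and multiplicity `1` at the SAME `μ₀` (`E` has CM by `k`, embedded so
that `k` acts on `T_{T × E,0}` with multiplicities `(2,2)`). Then `(T × E, φ × χ)` satisfies the tree's
`IsDivisorWeilGenerated … 2 d`: every rational `(p,p)`-class is a `ℂ`-combination of products of divisor classes for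
`p ≠ 2`, and of those and the Weil classes `weilClassesOf (T × E) (φ × χ) 2 d` for `p = 2` — «(1) Suppose we are in case
(a) … Then the Hodge ring `B•(X)` is generated by the subalgebra `D•(X)` of divisor classes together with the space of
Weil classes `W_k ⊂ B²(X)`» for (a1) `End⁰(X₂) = k`. Proof: the invariance theorem with Weil words
(`AVSlots.exists_coeff_eq_zero_off_balanced_or_weilWord_of_prod_unitaryTwoOne_cmCurve`; Lie step: the annihilator
contains `ι_T 𝔰𝔲_k(H¹T) π_T`, i.e. «`Hg(X) ⊇ {1} × SU`» in Lie form) splits the letter expansion of a rational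
`(2,2)`-class `c` as `c = c_B + c_W`: `c_W` (Weil words: all letters `μ̄₀`- resp. `μ₀`-eigenvectors of `(φ × χ)^*`) lies
in the Weil plane (`cupPowOne_mem_pullbackEigenclasses_pow`) and is of type `(2,2)` (`(T × E, φ × χ)` is of Weil type);
it is RATIONAL because it is the Künneth component of `c` of `E`-degree `1` (Weil words carry exactly one `E`-letter,
balanced words an even number of `T`-letters; `complexBetti_kunneth_bijective`, `isRationalClass_kunneth_symm_apply`);
hence `c_B = c - c_W` is a rational `(2,2)`-class in the span of typed products, so a combination of products of rational
Hodge classes of `T` and `E` (`mem_span_hodgeProductClasses_of_mem_span_pureType`), which are divisor classes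
(`B(T) = D(T)`, `B(E) = D(E)`, `dim ≤ 3`). Degrees `p ≠ 2` on the fourfold `T × E` are Lefschetz
(`hodgeClasses_divisorial_of_le_one_or_le_succ`). NOT asserted: `D² ≠ B²` (Thm. 0.1: «in these cases we have
`D²(X) ≠ B²(X)`»), nor the algebraicity of `W_k`.
[cite: MoonenZarhin1999LowDim, Thm. 0.1 (1) with case (a) and §5 (5.3)] [cite: MoonenZarhin1999LowDim, (1.9)]
[cite: vanGeemen1994HodgeAV, 4.9 and Thm. 6.12] [cite: HatcherAT2002, §3.2 Thm. 3.16] -/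
theorem isDivisorWeilGenerated_prod_cmCurve_of_unitaryTwoOne (hY3 : Y.dim = 3)
    (hY2 : Module.finrank ℚ Y.endAlgebra = 2) (φY : Y ⟶ Y) {d : ℕ} (hd : 0 < d) (hφY : φY ≫ φY = -(d • 𝟙 Y)) {μ₀ : ℂ}
    (hμ₀ : μ₀ = Complex.I * (Real.sqrt d : ℂ) ∨ μ₀ = -(Complex.I * (Real.sqrt d : ℂ)))
    (hmY : eigenMultiplicity Y φY μ₀ = 1) (hE1 : E.dim = 1) (χ : E ⟶ E) (hχ : χ ≫ χ = -(d • 𝟙 E))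
    (hmE : eigenMultiplicity E χ μ₀ = 1) :
    IsDivisorWeilGenerated (Y.prod E) (Motives.AbelianVariety.prodLift (Motives.AbelianVariety.fst Y E ≫ φY)
      (Motives.AbelianVariety.snd Y E ≫ χ)) 2 d := by
  classical
  set ψ := Motives.AbelianVariety.prodLift (Motives.AbelianVariety.fst Y E ≫ φY) (Motives.AbelianVariety.snd Y E ≫ χ)
    with hψ
  have hdim : (Y.prod E).dim = 2 * 2 := by rw [Motives.AbelianVariety.dim_prod, hY3, hE1]
  have hXP : IsSmoothProjective (Y.prod E).dim (Y.prod E).X := AbelianVariety.isSmoothProjective_holds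
  have hYs : IsSmoothProjective Y.dim Y.X := AbelianVariety.isSmoothProjective_holds
  have hEs : IsSmoothProjective E.dim E.X := AbelianVariety.isSmoothProjective_holds
  refine ⟨fun p c hp2 hcQ hc => ?_, fun c hcQ hc => ?_⟩
  · -- degrees `p ≠ 2` on a fourfold
    exact hodgeClasses_divisorial_of_le_one_or_le_succ hXP (by omega) c hcQ hc
  -- degree `4`: the invariance theorem with Weil words, for `T × E` itself (one slot)
  obtain ⟨hA, bA, h, cC, κ, hbA0, hbA1, hcC0, hcC1, hbAe, hcCe, hmain⟩ :=
    (avSlots_self (Y.prod E)).exists_coeff_eq_zero_off_balanced_or_weilWord_of_prod_unitaryTwoOne_cmCurve hY3 hY2 φY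
      hd hφY hμ₀ hmY hE1 χ hχ hmE
  obtain ⟨a, hca, hsupp⟩ := hmain two_pos hcQ hc
  -- counts
  have hh1 : h = 1 := by
    haveI : Module.Finite ℚ (bettiCohomology E.X 1) := finite_bettiCohomology_one E
    have hcard := Module.finrank_eq_card_basis cC
    rw [Module.finrank_baseChange, finrank_bettiCohomology_one E, hE1, Fintype.card_prod, Fintype.card_fin,
      Fintype.card_fin] at hcard
    omega
  -- the letters, freed of the identity slot
  set xA : (Fin 1 × Fin hA) × Fin 2 → complexBetti Y.X 1 := fun jr =>
    ofRatClassBaseChange (Motives.ComplexPoints Y.X) 1 (bA (jr.1.2, jr.2)) with hxA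
  set y : (Fin 1 × Fin h) × Fin 2 → complexBetti E.X 1 := fun jr =>
    ofRatClassBaseChange (Motives.ComplexPoints E.X) 1 (cC (jr.1.2, jr.2)) with hy
  set L : (Fin 1 × (Fin hA ⊕ Fin h)) × Fin 2 → complexBetti (Y.prod E).X 1 := fun jr => Sum.elim
    (fun i => complexBetti.map (Motives.AbelianVariety.fst Y E).hom.hom.hom 1 (xA ((jr.1.1, i), jr.2)))
    (fun i => complexBetti.map (Motives.AbelianVariety.snd Y E).hom.hom.hom 1 (y ((jr.1.1, i), jr.2))) jr.1.2 with hL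
  have hletters : (fun jr : (Fin 1 × (Fin hA ⊕ Fin h)) × Fin 2 => complexBetti.map ((![𝟙 (Y.prod E)]) jr.1.1).hom.hom.hom 1
      (Sum.elim
        (fun i => complexBetti.map (Motives.AbelianVariety.fst Y E).hom.hom.hom 1
          (ofRatClassBaseChange (Motives.ComplexPoints Y.X) 1 (bA (i, jr.2))))
        (fun i => complexBetti.map (Motives.AbelianVariety.snd Y E).hom.hom.hom 1
          (ofRatClassBaseChange (Motives.ComplexPoints E.X) 1 (cC (i, jr.2))))
        jr.1.2)) = L := by
    funext jr
    obtain ⟨⟨j, t⟩, r⟩ := jr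
    have hj : j = 0 := Subsingleton.elim _ _
    subst hj
    change complexBetti.map (𝟙 (Y.prod E).X) 1 _ = _
    rw [complexBetti.map_id]
    rcases t with i | i <;> rfl
  rw [hletters] at hca
  -- Weil words
  let WP : (Fin (2 * 2) → (Fin 1 × (Fin hA ⊕ Fin h)) × Fin 2) → Prop := fun w =>
    ∀ t, Sum.elim (fun ℓ => (w t).2 = κ ℓ) (fun _ => (w t).2 = 1) (w t).1.2
  let WM : (Fin (2 * 2) → (Fin 1 × (Fin hA ⊕ Fin h)) × Fin 2) → Prop := fun w =>
    ∀ t, Sum.elim (fun ℓ => (w t).2 ≠ κ ℓ) (fun _ => (w t).2 = 0) (w t).1.2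
  set aW : (Fin (2 * 2) → (Fin 1 × (Fin hA ⊕ Fin h)) × Fin 2) → ℂ := fun w => if WP w ∨ WM w then a w else 0 with haW
  set aB : (Fin (2 * 2) → (Fin 1 × (Fin hA ⊕ Fin h)) × Fin 2) → ℂ := fun w => if WP w ∨ WM w then 0 else a w with haB
  have hsplit : a = aB + aW := by
    funext w
    simp only [haB, haW, Pi.add_apply]
    split_ifs <;> simp
  set F := cupPowOneAlt ℂ (Motives.ComplexPoints (Y.prod E).X) (2 * 2) with hF
  set cW := wordEval F L aW with hcW
  set cB := wordEval F L aB with hcB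
  have hc_eq : c = cB + cW := by rw [← hca, hsplit, map_add]
  -- (1) `c_W ∈ W_k ⊗ ℂ`
  have hνP : starRingEnd ℂ μ₀ = Complex.I * (Real.sqrt d : ℂ) ∨ starRingEnd ℂ μ₀ = -(Complex.I * (Real.sqrt d : ℂ)) := by
    rcases hμ₀ with h0 | h0
    · right; rw [h0, map_mul, Complex.conj_I, Complex.conj_ofReal, neg_mul]
    · left; rw [h0, map_neg, map_mul, Complex.conj_I, Complex.conj_ofReal, neg_mul, neg_neg]
  have hletter_eig : ∀ (w : Fin (2 * 2) → (Fin 1 × (Fin hA ⊕ Fin h)) × Fin 2), (WP w ∨ WM w) →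
      ∃ ν : ℂ, (ν = Complex.I * (Real.sqrt d : ℂ) ∨ ν = -(Complex.I * (Real.sqrt d : ℂ))) ∧
        ∀ t, L (w t) ∈ Module.End.eigenspace (complexBetti.map ψ.hom.hom.hom 1).hom ν := by
    intro w hw
    rcases hw with hw | hw
    · refine ⟨starRingEnd ℂ μ₀, hνP, fun t => ?_⟩
      have hwt := hw t
      simp only [hL]
      rcases hPt : (w t).1.2 with ℓ | i
      · rw [hPt] at hwt; simp only [Sum.elim_inl] at hwt ⊢
        refine map_fst_mem_eigenspace_prodLift φY χ ?_
        have h' := hbAe ℓ (w t).2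
        rw [if_pos hwt] at h'
        exact h'
      · rw [hPt] at hwt; simp only [Sum.elim_inr] at hwt ⊢
        refine map_snd_mem_eigenspace_prodLift φY χ ?_
        have h' := hcCe i (w t).2
        rw [if_pos hwt] at h'
        exact h'
    · refine ⟨μ₀, hμ₀, fun t => ?_⟩
      have hwt := hw t
      simp only [hL]
      rcases hPt : (w t).1.2 with ℓ | i
      · rw [hPt] at hwt; simp only [Sum.elim_inl] at hwt ⊢
        refine map_fst_mem_eigenspace_prodLift φY χ ?_
        have h' := hbAe ℓ (w t).2
        rw [if_neg hwt] at h'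
        exact h'
      · rw [hPt] at hwt; simp only [Sum.elim_inr] at hwt ⊢
        refine map_snd_mem_eigenspace_prodLift φY χ ?_
        have h' := hcCe i (w t).2
        rw [if_neg (by rw [hwt]; decide)] at h'
        exact h'
  have hcW_mem : cW ∈ weilClassesOf (Y.prod E) ψ 2 d := by
    rw [hcW, wordEval_apply]
    refine Submodule.sum_mem _ fun w _ => ?_
    by_cases hw : WP w ∨ WM w
    · simp only [haW, if_pos hw]
      refine Submodule.smul_mem _ _ ?_
      rw [hF, cupPowOneAlt_apply]
      obtain ⟨ν, hν, hνt⟩ := hletter_eig w hw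
      exact mem_weilClassesOf_of_mem_pullbackEigenclasses_pow ψ hν (cupPowOne_mem_pullbackEigenclasses_pow ψ hνt)
    · simp only [haW, if_neg hw, zero_smul]
      exact Submodule.zero_mem _
  -- (2) `c_W` is of type `(2,2)` (Weil type), hence so is `c_B = c - c_W`
  have hWT := isWeilType_prod_cmCurve_of_unitaryTwoOne hY3 φY hd hφY hμ₀ hmY hE1 χ hχ hmE
  have hcW22 : IsOfHodgeType (Y.prod E).dim (Y.prod E).X (2 * 2) 2 2 cW := by
    rw [hdim]; exact hWT.isOfHodgeType_of_mem_weilClassesOf hcW_mem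
  have hcB22 : IsOfHodgeType (Y.prod E).dim (Y.prod E).X (2 * 2) 2 2 cB := by
    have e : cB = c - cW := by rw [hc_eq, add_sub_cancel_right]
    rw [e]; exact hc.sub hXP hcW22
  -- (3) `c_B` lies in the span of the typed products
  have hcB_mem := wordEval_mem_span_typed_cup_pureType_of_eq_zero_off_balanced
    (Motives.AbelianVariety.fst Y E) (Motives.AbelianVariety.snd Y E) xA y
    (fun jr hjr => by obtain ⟨⟨j, i⟩, r⟩ := jr; change r = 0 at hjr; subst hjr; exact hbA0 i)
    (fun jr hjr => by obtain ⟨⟨j, i⟩, r⟩ := jr; change r = 1 at hjr; subst hjr; exact hbA1 i)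
    (fun jr hjr => by obtain ⟨⟨j, i⟩, r⟩ := jr; change r = 0 at hjr; subst hjr; exact hcC0 i)
    (fun jr hjr => by obtain ⟨⟨j, i⟩, r⟩ := jr; change r = 1 at hjr; subst hjr; exact hcC1 i)
    (p := 2) (a := aB) (fun U η hU => by
      by_cases hw : WP (fun t => (U t, η t)) ∨ WM (fun t => (U t, η t))
      · simp only [haB, if_pos hw]
      · simp only [haB, if_neg hw]
        by_contra hne
        obtain ⟨-, hbal | hplus | hminus⟩ := hsupp U η hne
        · apply hU
          have hcast : ∀ t, Sum.elim (fun _ : Fin hA => if η t = 0 then (1 : ℂ) else -1) (fun _ : Fin h => (0 : ℂ))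
              (U t).2 = ((Sum.elim (fun _ : Fin hA => if η t = 0 then (1 : ℤ) else -1) (fun _ : Fin h => (0 : ℤ))
                (U t).2 : ℤ) : ℂ) := by
            intro t
            rcases (U t).2 with ℓ | e
            · simp only [Sum.elim_inl]; split_ifs <;> simp
            · simp
          simp only [hcast]
          rw [← Int.cast_sum, hbal, Int.cast_zero]
        · exact hw (Or.inl hplus.1)
        · exact hw (Or.inr hminus.1))
  -- (4) RATIONALITY of `c_W`: it is the Künneth component of `c` of `E`-degree `1`
  have hb : ∀ j : Fin (2 * E.dim + 1), ∃ (r : ℕ) (b : Module.Basis (Fin r) ℂ (complexBetti E.X j)),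
      ∀ i, IsRationalClass (b i) := fun j => exists_basis_isRationalClass hEs j
  choose r b hbQ using hb
  have hbij : Function.Bijective (LerayHirsch.lhMap ℂ (fun J : (Σ j, Fin (r j)) => (J.1 : ℕ))
      (Motives.AlgPoints.mapContinuous (L := ℂ) (Motives.AbelianVariety.fst Y E).hom.hom.hom)
      (fun J => complexBetti.map (Motives.AbelianVariety.snd Y E).hom.hom.hom J.1 (b J.1 J.2)) (2 * 2)) :=
    complexBetti_kunneth_bijective hYs hEs b (2 * 2)
  set θ := LinearEquiv.ofBijective _ hbij with hθ
  have hθsum : ∀ a' : (Fin (2 * 2) → (Fin 1 × (Fin hA ⊕ Fin h)) × Fin 2) → ℂ,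
      θ.symm (∑ w, a' w • F (L ∘ w)) = ∑ w, θ.symm (a' w • F (L ∘ w)) := fun a' => map_sum θ.symm _ _
  have hθsmul : ∀ (s : ℂ) (x : complexBetti (Y.prod E).X (2 * 2)), θ.symm (s • x) = s • θ.symm x :=
    fun s x => map_smul θ.symm s x
  have hθadd : ∀ x x' : complexBetti (Y.prod E).X (2 * 2), θ.symm (x + x') = θ.symm x + θ.symm x' :=
    fun x x' => map_add θ.symm x x'
  -- Künneth coefficients of `pr_T^* u ⌣ pr_E^* v` vanish off the `E`-degree of `v`
  have hvan : ∀ (m r' : ℕ) (hmr : m + r' = 2 * 2) (u : complexBetti Y.X m) (v : complexBetti E.X r')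
      (J : LerayHirsch.Idx (fun J : (Σ j, Fin (r j)) => (J.1 : ℕ)) (2 * 2)), (J.1.1 : ℕ) ≠ r' →
      θ.symm (cupProduct hmr (complexBetti.map (Motives.AbelianVariety.fst Y E).hom.hom.hom m u)
        (complexBetti.map (Motives.AbelianVariety.snd Y E).hom.hom.hom r' v)) J = 0 := by
    intro m r' hmr u v J hJ
    by_cases hr2 : r' ≤ 2 * E.dim
    · obtain rfl : m = 2 * 2 - r' := by omega
      have key : θ.symm (cupProduct hmr (complexBetti.map (Motives.AbelianVariety.fst Y E).hom.hom.hom (2 * 2 - r') u)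
          (complexBetti.map (Motives.AbelianVariety.snd Y E).hom.hom.hom r' v)) = _ :=
        kunneth_symm_cupProduct_eq_sum hYs hEs b (2 * 2) (j := ⟨r', by omega⟩) (by change r' ≤ 2 * 2; omega) u v
      rw [key, Finset.sum_apply]
      refine Finset.sum_eq_zero fun i _ => ?_
      rw [Pi.smul_apply, Pi.single_eq_of_ne, smul_zero]
      intro hJi
      apply hJ
      rw [hJi]
    · haveI := subsingleton_complexBetti hEs (lt_of_not_ge hr2)
      have hv : v = 0 := Subsingleton.elim _ _
      rw [hv, map_zero, map_zero]
      exact congrFun (map_zero θ.symm) J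
  -- every word's monomial is `± pr_T^*(T-monomial) ⌣ pr_E^*(E-monomial)`, the `E`-degree being the number of `E`-positions
  have hterm : ∀ w : Fin (2 * 2) → (Fin 1 × (Fin hA ⊕ Fin h)) × Fin 2,
      ∃ (m r' : ℕ) (hmr : m + r' = 2 * 2) (u : complexBetti Y.X m) (v : complexBetti E.X r') (s : ℂ),
        F (L ∘ w) = s • cupProduct hmr (complexBetti.map (Motives.AbelianVariety.fst Y E).hom.hom.hom m u)
          (complexBetti.map (Motives.AbelianVariety.snd Y E).hom.hom.hom r' v) ∧
        m = Fintype.card {t // ((w t).1.2).isLeft = true} ∧ r' = Fintype.card {t // ¬ ((w t).1.2).isLeft = true} := by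
    intro w
    set col : Fin (2 * 2) → Fin hA ⊕ Fin h := fun t => (w t).1.2 with hcol
    set m := Fintype.card {t // (col t).isLeft = true} with hm
    set r' := Fintype.card {t // ¬ (col t).isLeft = true} with hr'
    have hmr : m + r' = 2 * 2 := card_isLeft_add_card_not_isLeft_w col
    obtain ⟨φ, τA, iC, hAcol, hCcol⟩ := exists_leftSplit col hm.symm hr'.symm
    set wA : Fin m → (Fin 1 × Fin hA) × Fin 2 := fun a' =>
      (((w (φ.symm (Sum.inl a'))).1.1, τA a'), (w (φ.symm (Sum.inl a'))).2) with hwA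
    set wC : Fin r' → (Fin 1 × Fin h) × Fin 2 := fun b' =>
      (((w (φ.symm (Sum.inr b'))).1.1, iC b'), (w (φ.symm (Sum.inr b'))).2) with hwC
    have hword : (L ∘ w) = fun t => Sum.elim
        (fun a' => complexBetti.map (Motives.AbelianVariety.fst Y E).hom.hom.hom 1 (xA (wA a')))
        (fun b' => complexBetti.map (Motives.AbelianVariety.snd Y E).hom.hom.hom 1 (y (wC b'))) (φ t) := by
      funext t
      obtain ⟨s, rfl⟩ := φ.symm.surjective t
      rw [Function.comp_apply, Equiv.apply_symm_apply]
      rcases s with a' | b'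
      · have h1 : (w (φ.symm (Sum.inl a'))).1.2 = Sum.inl (τA a') := hAcol a'
        simp only [hL, h1, Sum.elim_inl, hwA]
      · have h1 : (w (φ.symm (Sum.inr b'))).1.2 = Sum.inr (iC b') := hCcol b'
        simp only [hL, h1, Sum.elim_inr, hwC]
    refine ⟨m, r', hmr, cupPowOne ℂ (Motives.ComplexPoints Y.X) m (xA ∘ wA),
      cupPowOne ℂ (Motives.ComplexPoints E.X) r' (y ∘ wC),
      (((Equiv.Perm.sign (φ.trans (finSumFinEquiv.trans (finCongr hmr))) : ℤˣ) : ℤ) : ℂ), ?_, rfl, rfl⟩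
    rw [hF, cupPowOneAlt_apply, hword, cupPowOne_sumElim_eq_sign_smul_cupProduct ℂ φ hmr,
      ← Motives.complexBetti_map_cupPowOne, ← Motives.complexBetti_map_cupPowOne]
    rfl
  -- `E`-degrees: Weil words `1`, balanced words even
  have hdegW : ∀ w : Fin (2 * 2) → (Fin 1 × (Fin hA ⊕ Fin h)) × Fin 2, (WP w ∨ WM w) → a w ≠ 0 →
      Fintype.card {t // ¬ ((w t).1.2).isLeft = true} = 1 := by
    intro w hw hne
    have hsupp' := hsupp (fun t => (w t).1) (fun t => (w t).2) (by simpa using hne)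
    obtain ⟨hinjP, htri⟩ := hsupp'
    -- the place map of `w` is injective: the kind is determined by the place on a Weil word
    have hinjPl : Function.Injective fun t => (w t).1.2 := by
      intro t t' htt
      simp only at htt
      apply hinjP
      simp only [Prod.mk.injEq]
      refine ⟨htt, ?_⟩
      rcases hw with hw | hw
      · have h1 := hw t; have h2 := hw t'
        rcases hPt : (w t).1.2 with ℓ | i
        · rw [hPt] at h1; rw [← htt, hPt] at h2; simp only [Sum.elim_inl] at h1 h2; rw [h1, h2]
        · rw [hPt] at h1; rw [← htt, hPt] at h2; simp only [Sum.elim_inr] at h1 h2; rw [h1, h2]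
      · have h1 := hw t; have h2 := hw t'
        rcases hPt : (w t).1.2 with ℓ | i
        · rw [hPt] at h1; rw [← htt, hPt] at h2; simp only [Sum.elim_inl] at h1 h2
          rw [fin2_eq_one_sub_of_ne h1, fin2_eq_one_sub_of_ne h2]
        · rw [hPt] at h1; rw [← htt, hPt] at h2; simp only [Sum.elim_inr] at h1 h2; rw [h1, h2]
    -- an `E`-letter is present: otherwise `4` injective `T`-places in `Fin hA`, `hA = 3`
    have hA3 : hA = 3 := by
      haveI : Module.Finite ℚ (bettiCohomology Y.X 1) := finite_bettiCohomology_one Y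
      have hcard := Module.finrank_eq_card_basis bA
      rw [Module.finrank_baseChange, finrank_bettiCohomology_one Y, hY3, Fintype.card_prod, Fintype.card_fin,
        Fintype.card_fin] at hcard
      omega
    have hex : ∃ t e, (w t).1.2 = Sum.inr e := by
      by_contra hno
      have hall : ∀ t, ∃ ℓ, (w t).1.2 = Sum.inl ℓ := fun t => by
        rcases hPt : (w t).1.2 with ℓ | e
        · exact ⟨ℓ, rfl⟩
        · exact absurd ⟨t, e, hPt⟩ hno
      choose f hf using hall
      have hfinj : Function.Injective f := fun t t' h => hinjPl (by simp only [hf t, hf t', h])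
      have := Fintype.card_le_of_injective f hfinj
      simp only [Fintype.card_fin] at this
      omega
    exact card_not_isLeft_eq_one (fun t => (w t).1.2) hinjPl (by omega) hex
  have hdegB : ∀ w : Fin (2 * 2) → (Fin 1 × (Fin hA ⊕ Fin h)) × Fin 2, ¬ (WP w ∨ WM w) → a w ≠ 0 →
      Fintype.card {t // ¬ ((w t).1.2).isLeft = true} ≠ 1 := by
    intro w hw hne
    obtain ⟨-, hbal | hplus | hminus⟩ := hsupp (fun t => (w t).1) (fun t => (w t).2) (by simpa using hne)
    · have hev := even_card_isLeft_of_balanced (fun t => (w t).1.2) (fun t => (w t).2) hbal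
      have hmr := card_isLeft_add_card_not_isLeft_w (fun t => (w t).1.2)
      obtain ⟨k, hk⟩ := hev
      omega
    · exact absurd (Or.inl hplus.1) hw
    · exact absurd (Or.inr hminus.1) hw
  -- Künneth coefficients: `c_W` has only `E`-degree-`1` coefficients, `c_B` none
  have hθW : ∀ J : LerayHirsch.Idx (fun J : (Σ j, Fin (r j)) => (J.1 : ℕ)) (2 * 2), (J.1.1 : ℕ) ≠ 1 → θ.symm cW J = 0 := by
    intro J hJ
    rw [hcW, wordEval_apply, hθsum, Finset.sum_apply]
    refine Finset.sum_eq_zero fun w _ => ?_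
    rw [hθsmul, Pi.smul_apply]
    by_cases hw : WP w ∨ WM w
    · by_cases hne : a w = 0
      · simp only [haW, if_pos hw, hne, zero_smul]
      · obtain ⟨m, r', hmr, u, v, s, hFw, -, hr'⟩ := hterm w
        have h1 : r' = 1 := by rw [hr']; exact hdegW w hw hne
        rw [hFw, hθsmul, Pi.smul_apply, hvan m r' hmr u v J (by rw [h1]; exact hJ), smul_zero, smul_zero]
    · simp only [haW, if_neg hw, zero_smul]
  have hθB : ∀ J : LerayHirsch.Idx (fun J : (Σ j, Fin (r j)) => (J.1 : ℕ)) (2 * 2), (J.1.1 : ℕ) = 1 → θ.symm cB J = 0 := by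
    intro J hJ
    rw [hcB, wordEval_apply, hθsum, Finset.sum_apply]
    refine Finset.sum_eq_zero fun w _ => ?_
    rw [hθsmul, Pi.smul_apply]
    by_cases hw : WP w ∨ WM w
    · simp only [haB, if_pos hw, zero_smul]
    · by_cases hne : a w = 0
      · simp only [haB, if_neg hw, hne, zero_smul]
      · obtain ⟨m, r', hmr, u, v, s, hFw, -, hr'⟩ := hterm w
        have h1 : r' ≠ 1 := by rw [hr']; exact hdegB w hw hne
        rw [hFw, hθsmul, Pi.smul_apply, hvan m r' hmr u v J (by rw [hJ]; exact Ne.symm h1), smul_zero, smul_zero]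
  -- `θ⁻¹ c_W` is the `E`-degree-`1` truncation of `θ⁻¹ c`, whose entries are rational
  set a₁ : LerayHirsch.Src ℂ (fun J : (Σ j, Fin (r j)) => (J.1 : ℕ)) (Motives.ComplexPoints Y.X) (2 * 2) :=
    fun J => if (J.1.1 : ℕ) = 1 then θ.symm c J else 0 with ha₁
  have hθcW : θ.symm cW = a₁ := by
    funext J
    by_cases hJ : (J.1.1 : ℕ) = 1
    · rw [ha₁]; simp only [if_pos hJ]
      rw [hc_eq, hθadd, Pi.add_apply, hθB J hJ, zero_add]
    · rw [ha₁]; simp only [if_neg hJ]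
      exact hθW J hJ
  have hcW_eq : cW = θ a₁ := by rw [← hθcW, LinearEquiv.apply_symm_apply]
  have hcWQ : IsRationalClass cW := by
    rw [hcW_eq, hθ, LinearEquiv.ofBijective_apply, LerayHirsch.lhMap_apply]
    refine isRationalClass_sum _ _ fun J _ => ?_
    split_ifs with hJk
    · refine (IsRationalClass.map _ ?_).cup _ ((hbQ J.1 J.2).map _)
      rw [ha₁]
      dsimp only
      split_ifs with hJ1
      · exact isRationalClass_kunneth_symm_apply hYs hEs b hbQ (2 * 2) hcQ ⟨J, hJk⟩
      · exact IsRationalClass.zero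
    · exact IsRationalClass.zero
  have hcBQ : IsRationalClass cB := by
    have e : cB = c - cW := by rw [hc_eq, add_sub_cancel_right]
    rw [e]; exact hcQ.sub hcWQ
  -- (5) conclusion: `c_B ∈ D²`, `c_W ∈ W_k`
  rw [hc_eq]
  refine Submodule.add_mem_sup ?_ hcW_mem
  have hcB22' : IsOfHodgeType (Y.dim + E.dim) (Y.X ⊗ E.X) (2 * 2) 2 2 cB := by
    rw [← Motives.AbelianVariety.dim_prod]; exact hcB22
  have hspan := mem_span_hodgeProductClasses_of_mem_span_pureType Y E hcBQ hcB22' (Submodule.span_mono ?_ hcB_mem)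
  swap
  · rintro z ⟨i, j, hij, dd, μ, hdd, hμ, rfl⟩
    exact ⟨i, j, hij, dd, μ, hdd, hμ, rfl⟩
  rw [Motives.AbelianVariety.dim_prod]
  exact Submodule.span_le.2 (hodgeProductClasses_subset_divisorClassesSpan Y E
    (isDivisorGenerated_of_dim_le_three Y (by omega)) (isDivisorGenerated_of_dim_le_three E (by omega)) 2) hspan

end DivisorWeil

/-! ### §6 Consequences: the isogeny class, and the Hodge conjecture for `T × E_k` modulo the Weil classes of fourfolds -/

section Consequences

variable {Y E : AbelianVariety ℂ}

/-- **Everything isogenous to `T × E_k` carries a `k`-structure of Weil type `(2, D)` with `B = D + W_k`** (van Geemen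
3.6–3.7: isogenies transport Hodge classes, divisor classes and Weil planes; the tree's
`IsWeilType.exists_isDivisorWeilGenerated_of_isIsogenous'`). This is Moonen–Zarhin's case (a1) as printed («`X` is
isogenous to a product `X₁ × X₂` …»), for `End⁰(X₂) = k`.
[cite: MoonenZarhin1999LowDim, Thm. 0.1 (1) with case (a)] [cite: vanGeemen1994HodgeAV, 3.6–3.7 (p. 236) and Thm. 6.12] -/
theorem exists_isWeilType_isDivisorWeilGenerated_of_isIsogenous_unitaryTwoOne_prod_cmCurve {X : AbelianVariety ℂ}
    (hY3 : Y.dim = 3) (hY2 : Module.finrank ℚ Y.endAlgebra = 2) (φY : Y ⟶ Y) {d : ℕ} (hd : 0 < d)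
    (hφY : φY ≫ φY = -(d • 𝟙 Y)) {μ₀ : ℂ}
    (hμ₀ : μ₀ = Complex.I * (Real.sqrt d : ℂ) ∨ μ₀ = -(Complex.I * (Real.sqrt d : ℂ)))
    (hmY : eigenMultiplicity Y φY μ₀ = 1) (hE1 : E.dim = 1) (χ : E ⟶ E) (hχ : χ ≫ χ = -(d • 𝟙 E))
    (hmE : eigenMultiplicity E χ μ₀ = 1) (hX : AbelianVariety.IsIsogenous X (Y.prod E)) :
    ∃ (ψ : X ⟶ X) (D : ℕ), IsWeilType X ψ 2 D ∧ IsDivisorWeilGenerated X ψ 2 D :=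
  (isWeilType_prod_cmCurve_of_unitaryTwoOne hY3 φY hd hφY hμ₀ hmY hE1 χ hχ hmE).exists_isDivisorWeilGenerated_of_isIsogenous'
    (isDivisorWeilGenerated_prod_cmCurve_of_unitaryTwoOne hY3 hY2 φY hd hφY hμ₀ hmY hE1 χ hχ hmE) hX

/-- **The Hodge conjecture for `T × E_k` MODULO the algebraicity of the Weil classes of abelian FOURFOLDS** (the tree's
named fact `Markman2025_weilClasses_algebraic_abelianFourfold`, taken as a hypothesis — NOT discharged here): with
`B•(T × E) ⊆ D• + W_k` (this file), Lefschetz `(1,1)` and the algebraicity of products of divisor classes (the tree's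
`lefschetzOneOne_rational_holds`, `AbelianVariety.divisorClassesSpan_le_algebraicClasses`), van Geemen's reduction
`hodgeConjectureFor_of_isDivisorWeilGenerated_of_weilClasses` applies. Moonen–Zarhin: «in these cases we have
`D²(X) ≠ B²(X)`» — the Weil classes are genuinely needed. [cite: vanGeemen1994HodgeAV, Thm. 6.12 and 4.11]
[cite: MoonenZarhin1999LowDim, Thm. 0.1 (1) with case (a)] -/
theorem hodgeConjectureFor_prod_cmCurve_of_unitaryTwoOne_of_weilClassesFourfold
    (hMark : Markman2025_weilClasses_algebraic_abelianFourfold)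
    (hY3 : Y.dim = 3) (hY2 : Module.finrank ℚ Y.endAlgebra = 2) (φY : Y ⟶ Y) {d : ℕ} (hd : 0 < d)
    (hφY : φY ≫ φY = -(d • 𝟙 Y)) {μ₀ : ℂ}
    (hμ₀ : μ₀ = Complex.I * (Real.sqrt d : ℂ) ∨ μ₀ = -(Complex.I * (Real.sqrt d : ℂ)))
    (hmY : eigenMultiplicity Y φY μ₀ = 1) (hE1 : E.dim = 1) (χ : E ⟶ E) (hχ : χ ≫ χ = -(d • 𝟙 E))
    (hmE : eigenMultiplicity E χ μ₀ = 1) :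
    HodgeConjectureFor (Y.prod E).dim (Y.prod E).X :=
  hodgeConjectureFor_of_isDivisorWeilGenerated_of_weilClasses
    (isWeilType_prod_cmCurve_of_unitaryTwoOne hY3 φY hd hφY hμ₀ hmY hE1 χ hχ hmE)
    (isDivisorWeilGenerated_prod_cmCurve_of_unitaryTwoOne hY3 hY2 φY hd hφY hμ₀ hmY hE1 χ hχ hmE)
    (fun p => AbelianVariety.divisorClassesSpan_le_algebraicClasses (Y.prod E)
      (fun b hb hb' => lefschetzOneOne_rational_holds (AbelianVariety.isSmoothProjective_holds (A := Y.prod E)) b hb hb')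
      p)
    (fun A' φ' hA' hφ' c hc hH hcW => hMark d hd A' φ' hA' (Motives.isSmoothProjective_of_dim_eq' hA') hφ' c hc hH hcW)

/- **On path**: the Hodge conjecture gives every target of this file; here `B ⊆ D + W_k` is proved unconditionally and the
Hodge conjecture for `T × E_k` is reduced to the Weil classes of fourfolds. -/
example (h : ∀ ⦃n : ℕ⦄ ⦃S : Literature.AlgebraicGeometry.Motives.SchemeOver ℂ⦄,
      Literature.AlgebraicGeometry.Motives.IsSmoothProjective n S → HodgeConjectureFor n S) (X : AbelianVariety ℂ) :
    HodgeConjectureFor X.dim X.X :=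
  h Literature.AlgebraicGeometry.Motives.AbelianVariety.isSmoothProjective_holds

end Consequences

end Literature.AlgebraicGeometry.HodgeTheory

end
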